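import Literature.Analysis.FluidPDE.OseenKernelLp
import Literature.Analysis.FluidPDE.KatoWeightedDuhamel
import Literature.Analysis.FluidPDE.KatoLocalBoundedPicard
import Literature.Analysis.FluidPDE.LocalLerayPressureBoundTools
import HarnessLib

/-!
# Uniformly local (`L^p_uloc`) estimates for convolutions with the parabolic envelope, the
# Oseen–Koch–Tataru slices and the heat extension

Analysis/FluidPDE theorem file (no definitions, no named facts). Toolkit for the small-data
theory of the Navier–Stokes equations in uniformly local spaces on `ℝ³`
(Lemarié-Rieusset 2016, Thm. 14.8, proof, Step 2, PDF pp. 521–523: the estimates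
`‖e^{νtΔ}u‖_{L³_uloc} ≤ ‖u‖_{L³_uloc}`, `√t ‖e^{νtΔ}u‖_∞ ≤ C‖u‖_{L³_uloc}`,
`‖B(v,w)(t)‖_∞ ≤ C∫(t-s)^{-3/4}‖v‖_{L⁶_uloc}‖w‖_∞`, `‖B(v,w)(t)‖_{E³} ≤ C∫(t-s)^{-1/2}‖v⊗w‖_{L³_uloc}`,
all obtained from the size of the kernels by splitting into a near part, estimated by Young's or
Hölder's inequality on the doubled ball, and a far part, summed over unit balls:
"`φ₀(x-k)|W| ≤ |∫ … ψ₀(.-k)F| + C ∫∫_{|x-y|>5} |x-y|^{-4} |F(s,y)| dy`"). Uniformly local sizes are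
rendered, as everywhere in the tree, by hypotheses `∀ x₀, (quantity on B(x₀,1)) ≤ A`.

Contents:

* `lintegral_rpow_lintegral_mul_le` — Young `L¹ × Lᵖ → Lᵖ` for an `ℝ≥0∞` majorant
  `x ↦ ∫ |K(y)| |f(x-y)| dy` (the proof of the tree's `lintegral_rpow_enorm_le_of_dominated`);
* `lintegral_far_envelope_mul_le` — the far part: `∫_{|x-y|≥1} (σ+|x-y|²)^{-2} g(y) dy ≤ C_far A`
  when `∫_{B(z,1)} g ≤ A` for all `z` (averaging over unit balls,
  `lintegral_mul_le_of_forall_lintegral_ball_le`);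
* `lintegral_envelope_mul_le_near_add_far` — the near/far splitting of the envelope convolution
  on a unit ball;
* `eLpNorm_ball_le_of_dominated_envelope`, `enorm_le_of_dominated_envelope` — the uniformly local
  Young bound on unit balls and the pointwise Hölder bound for operators dominated by the
  envelope convolution;
* the instances for the Oseen slices `T_σ[a,b] = e^{σΔ}P∇·(a⊗b)` and the heat extension
  `e^{sΔ}f`, with the sizes `‖Env_σ‖₁ ∝ σ^{-1/2}`, `‖Env_σ‖_{6/5} ∝ σ^{-3/4}`, `‖Env_σ‖_{3/2} ∝ σ^{-1}`.

## References

* P. G. Lemarié-Rieusset, *The Navier–Stokes Problem in the 21st Century*, CRC Press 2016,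
  Thm. 14.8, proof, Step 2 (PDF pp. 521–523); Prop. 6.4 / (6.10). [LemarieRieusset2016]
* H. Koch, D. Tataru, Adv. Math. 157 (2001), (14). [KochTataruAdvMath2001]
-/

noncomputable section

open MeasureTheory TopologicalSpace Set Function Filter Topology Metric
open scoped RealInnerProductSpace ENNReal NNReal Convolution

namespace Literature.Analysis.FluidPDE

/-! ### Young's inequality for an `ℝ≥0∞` majorant -/

section Majorant

variable {G : Type*} [MeasurableSpace G] [AddGroup G] {μ : Measure G}
  [MeasurableAdd₂ G] [MeasurableNeg G] [SFinite μ] [μ.IsAddRightInvariant]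

/-- **Young `L¹ × Lᵖ → Lᵖ` for the majorant itself**: for `1 ≤ p < ∞`,
`∫ (∫ |K(y)| |f(x-y)| dy)^p dx ≤ (∫ |K|)^p ∫ |f|^p` (the computation inside the tree's
`lintegral_rpow_enorm_le_of_dominated`, recorded for the `ℝ≥0∞`-valued majorant so that it can be
combined with other majorants before taking norms). [folklore] -/
theorem lintegral_rpow_lintegral_mul_le {K f : G → ℝ} (hK : AEStronglyMeasurable K μ)
    (hf : AEStronglyMeasurable f μ) {p : ℝ} (hp : 1 ≤ p) :
    ∫⁻ x, (∫⁻ y, ‖K y‖ₑ * ‖f (x - y)‖ₑ ∂μ) ^ p ∂μ ≤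
      (∫⁻ y, ‖K y‖ₑ ∂μ) ^ p * ∫⁻ x, ‖f x‖ₑ ^ p ∂μ := by
  have hp0 : 0 < p := one_pos.trans_le hp
  set A := ∫⁻ y, ‖K y‖ₑ ∂μ with hA
  have hKm : AEMeasurable (fun y => ‖K y‖ₑ) μ := hK.enorm
  have hfm2 : AEMeasurable (fun z : G × G => ‖f (z.1 - z.2)‖ₑ ^ p) (μ.prod μ) :=
    (hf.comp_quasiMeasurePreserving
      (quasiMeasurePreserving_sub_of_right_invariant μ μ)).enorm.pow_const _
  have hfm1 : ∀ x, AEMeasurable (fun y => ‖f (x - y)‖ₑ) μ := fun x =>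
    (hf.comp_quasiMeasurePreserving
      (quasiMeasurePreserving_sub_left_of_right_invariant μ x)).enorm
  have hfm3 : ∀ y, AEMeasurable (fun x => ‖f (x - y)‖ₑ ^ p) μ := fun y =>
    (hf.comp_quasiMeasurePreserving
      (measurePreserving_sub_right μ y).quasiMeasurePreserving).enorm.pow_const _
  have hG : AEMeasurable (fun z : G × G => ‖K z.2‖ₑ * ‖f (z.1 - z.2)‖ₑ ^ p) (μ.prod μ) :=
    hKm.comp_snd.mul hfm2
  calc ∫⁻ x, (∫⁻ y, ‖K y‖ₑ * ‖f (x - y)‖ₑ ∂μ) ^ p ∂μ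
      ≤ ∫⁻ x, A ^ (p - 1) * ∫⁻ y, ‖K y‖ₑ * ‖f (x - y)‖ₑ ^ p ∂μ ∂μ :=
        lintegral_mono fun x => UnboundedOperators.lintegral_mul_rpow_le_of_one_le hKm (hfm1 x) hp
    _ = A ^ (p - 1) * ∫⁻ y, ∫⁻ x, ‖K y‖ₑ * ‖f (x - y)‖ₑ ^ p ∂μ ∂μ := by
        rw [lintegral_const_mul'' _ hG.lintegral_prod_right', lintegral_lintegral_swap hG]
    _ = A ^ (p - 1) * ∫⁻ y, ‖K y‖ₑ * ∫⁻ x, ‖f x‖ₑ ^ p ∂μ ∂μ := by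
        congr 1
        refine lintegral_congr fun y => ?_
        rw [lintegral_const_mul'' _ (hfm3 y), lintegral_sub_right_eq_self (fun x => ‖f x‖ₑ ^ p) y]
    _ = A ^ p * ∫⁻ x, ‖f x‖ₑ ^ p ∂μ := by
        rw [lintegral_mul_const'' _ hKm, ← mul_assoc, ← hA]
        congr 1
        conv_rhs => rw [← sub_add_cancel p 1, ENNReal.rpow_add_of_nonneg _ _ (by linarith)
          zero_le_one, ENNReal.rpow_one]

/-- **`Lᵖ` form**: `(∫ (∫ |K(y)| |f(x-y)| dy)^p dx)^{1/p} ≤ (∫ |K|) ‖f‖_{Lᵖ}`, `1 ≤ p < ∞`.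
[folklore] -/
theorem rpow_lintegral_rpow_lintegral_mul_le {K f : G → ℝ} (hK : AEStronglyMeasurable K μ)
    (hf : AEStronglyMeasurable f μ) {p : ℝ≥0∞} (hp : 1 ≤ p) (hptop : p ≠ ∞) :
    (∫⁻ x, (∫⁻ y, ‖K y‖ₑ * ‖f (x - y)‖ₑ ∂μ) ^ p.toReal ∂μ) ^ (1 / p.toReal) ≤
      (∫⁻ y, ‖K y‖ₑ ∂μ) * eLpNorm f p μ := by
  have hp0 : p ≠ 0 := (zero_lt_one.trans_le hp).ne'
  have hp' : 1 ≤ p.toReal := by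
    simpa using (ENNReal.toReal_le_toReal ENNReal.one_ne_top hptop).2 hp
  have hp0' : 0 < p.toReal := one_pos.trans_le hp'
  rw [eLpNorm_eq_lintegral_rpow_enorm_toReal hp0 hptop]
  calc (∫⁻ x, (∫⁻ y, ‖K y‖ₑ * ‖f (x - y)‖ₑ ∂μ) ^ p.toReal ∂μ) ^ (1 / p.toReal)
      ≤ ((∫⁻ y, ‖K y‖ₑ ∂μ) ^ p.toReal * ∫⁻ x, ‖f x‖ₑ ^ p.toReal ∂μ) ^ (1 / p.toReal) :=
        ENNReal.rpow_le_rpow (lintegral_rpow_lintegral_mul_le hK hf hp') (by positivity)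
    _ = (∫⁻ y, ‖K y‖ₑ ∂μ) * (∫⁻ x, ‖f x‖ₑ ^ p.toReal ∂μ) ^ (1 / p.toReal) := by
        rw [ENNReal.mul_rpow_of_nonneg _ _ (by positivity), ← ENNReal.rpow_mul,
          mul_one_div_cancel hp0'.ne', ENNReal.rpow_one]

end Majorant

/-! ### The far part of the envelope convolution -/

section Far

/-- The dimension of `ℝ³`, as a real number. [folklore] -/
theorem finrank_real_euclideanSpace_fin_three :
    (Module.finrank ℝ (EuclideanSpace ℝ (Fin 3)) : ℝ) = 3 := by
  simp

/-- The Oseen exponent in `ℝ³`: `(d+1)/2 = 2`. [folklore] -/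
theorem oseen_exponent_eq_two :
    ((Module.finrank ℝ (EuclideanSpace ℝ (Fin 3)) : ℝ) + 1) / 2 = 2 := by
  rw [finrank_real_euclideanSpace_fin_three]; norm_num

/-- `∫_{ℝ³} (1 + ‖w‖²)^{-2} dw < ∞` (`2·2 > 3`). [folklore] -/
theorem lintegral_one_add_norm_sq_rpow_neg_two_lt_top :
    ∫⁻ w : EuclideanSpace ℝ (Fin 3), ENNReal.ofReal ((1 + ‖w‖ ^ 2) ^ (-(2 : ℝ))) < ∞ := by
  have he : (Module.finrank ℝ (EuclideanSpace ℝ (Fin 3)) : ℝ) < 2 * 2 := by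
    rw [finrank_real_euclideanSpace_fin_three]; norm_num
  exact (integrable_one_add_norm_sq_rpow_neg (E := EuclideanSpace ℝ (Fin 3)) he).lintegral_lt_top

/-- **The far weight is dominated on unit distance**: if `1 ≤ ‖x - y‖`, `dist z y < 1` and
`0 ≤ σ`, then `(σ + ‖x-y‖²)^{-2} ≤ 25 (1 + ‖x-z‖²)^{-2}` (as `1 + ‖x-z‖² ≤ 5‖x-y‖²`). [folklore] -/
theorem far_weight_le {σ : ℝ} (hσ : 0 ≤ σ) {x y z : EuclideanSpace ℝ (Fin 3)}
    (hxy : 1 ≤ ‖x - y‖) (hzy : dist z y < 1) :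
    (σ + ‖x - y‖ ^ 2) ^ (-(2 : ℝ)) ≤ 25 * (1 + ‖x - z‖ ^ 2) ^ (-(2 : ℝ)) := by
  have hxz : ‖x - z‖ ≤ ‖x - y‖ + 1 := by
    calc ‖x - z‖ = ‖(x - y) + (y - z)‖ := by rw [sub_add_sub_cancel]
      _ ≤ ‖x - y‖ + ‖y - z‖ := norm_add_le _ _
      _ ≤ ‖x - y‖ + 1 := by
          refine add_le_add le_rfl ?_
          rw [norm_sub_rev, ← dist_eq_norm]; exact hzy.le
  have h5 : 1 + ‖x - z‖ ^ 2 ≤ 5 * ‖x - y‖ ^ 2 := by nlinarith [norm_nonneg (x - z)]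
  have hpos : 0 < 1 + ‖x - z‖ ^ 2 := by positivity
  have hxy2 : 0 < ‖x - y‖ ^ 2 := by positivity
  -- `(σ + a)^{-2} ≤ a^{-2} ≤ 25 (1 + b)^{-2}`
  rw [Real.rpow_neg (by positivity), Real.rpow_neg hpos.le, Real.rpow_two, Real.rpow_two]
  calc ((σ + ‖x - y‖ ^ 2) ^ 2)⁻¹ ≤ ((‖x - y‖ ^ 2) ^ 2)⁻¹ := by
        gcongr
        linarith
    _ ≤ 25 * ((1 + ‖x - z‖ ^ 2) ^ 2)⁻¹ := by
        rw [← div_eq_mul_inv, le_div_iff₀ (by positivity)]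
        calc ((‖x - y‖ ^ 2) ^ 2)⁻¹ * (1 + ‖x - z‖ ^ 2) ^ 2
            ≤ ((‖x - y‖ ^ 2) ^ 2)⁻¹ * (5 * ‖x - y‖ ^ 2) ^ 2 := by gcongr
          _ = 25 := by field_simp; ring

/-- **The far part of the envelope convolution is bounded by the uniformly local `L¹` size**
(Lemarié-Rieusset 2016, p. 522: "`C∫_{|x-y|>5} |x-y|^{-4}|F(y)| dy ≤ C' Σ_j |j-k|^{-4}‖φ₀(.-j)F‖`";
here in the continuous form of the tree's averaging lemma): if `g ≥ 0` is measurable with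
`∫_{B(z,1)} g ≤ A` for every centre `z`, then for `σ ≥ 0` and every `x`,
`∫_{|x-y| ≥ 1} (σ + |x-y|²)^{-2} g(y) dy ≤ |B₁|⁻¹ · 25 ∫(1+|w|²)^{-2} dw · A`. [folklore] -/
theorem lintegral_far_envelope_mul_le {g : EuclideanSpace ℝ (Fin 3) → ℝ≥0∞}
    (hg : AEMeasurable g volume) {A : ℝ≥0∞}
    (hA : ∀ z : EuclideanSpace ℝ (Fin 3), ∫⁻ y in ball z 1, g y ≤ A) {σ : ℝ} (hσ : 0 ≤ σ)
    (x : EuclideanSpace ℝ (Fin 3)) :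
    ∫⁻ y, (ball x 1)ᶜ.indicator (fun y => ENNReal.ofReal ((σ + ‖x - y‖ ^ 2) ^ (-(2 : ℝ)))) y * g y ≤
      (volume (ball (0 : EuclideanSpace ℝ (Fin 3)) 1))⁻¹ *
        (A * (25 * ∫⁻ w : EuclideanSpace ℝ (Fin 3), ENNReal.ofReal ((1 + ‖w‖ ^ 2) ^ (-(2 : ℝ))))) := by
  set W : EuclideanSpace ℝ (Fin 3) → ℝ≥0∞ :=
    (ball x 1)ᶜ.indicator fun y => ENNReal.ofReal ((σ + ‖x - y‖ ^ 2) ^ (-(2 : ℝ))) with hW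
  set w : EuclideanSpace ℝ (Fin 3) → ℝ≥0∞ :=
    fun z => ENNReal.ofReal (25 * (1 + ‖x - z‖ ^ 2) ^ (-(2 : ℝ))) with hw
  have hwm : AEMeasurable w volume := by
    refine (Measurable.ennreal_ofReal ?_).aemeasurable
    exact measurable_const.mul ((measurable_const.add ((measurable_const.sub measurable_id).norm.pow_const 2)).pow_const _)
  have hWw : ∀ y z : EuclideanSpace ℝ (Fin 3), dist z y < 1 → W y ≤ w z := by
    intro y z hzy
    by_cases hy : y ∈ (ball x 1)ᶜ
    · rw [hW, indicator_of_mem hy, hw]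
      refine ENNReal.ofReal_le_ofReal (far_weight_le hσ ?_ hzy)
      rw [mem_compl_iff, mem_ball, dist_eq_norm, not_lt, ← norm_neg, neg_sub] at hy
      exact hy
    · rw [hW, indicator_of_notMem hy]
      exact zero_le
  have h := lintegral_mul_le_of_forall_lintegral_ball_le hg hwm hA hWw
  have hint : ∫⁻ z, w z = 25 * ∫⁻ w' : EuclideanSpace ℝ (Fin 3), ENNReal.ofReal ((1 + ‖w'‖ ^ 2) ^ (-(2 : ℝ))) := by
    have e1 : ∀ z, w z = ENNReal.ofReal 25 * ENNReal.ofReal ((1 + ‖x - z‖ ^ 2) ^ (-(2 : ℝ))) := fun z => by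
      change ENNReal.ofReal (25 * (1 + ‖x - z‖ ^ 2) ^ (-(2 : ℝ))) = _
      rw [ENNReal.ofReal_mul (by norm_num)]
    simp_rw [e1]
    rw [lintegral_const_mul' _ _ ENNReal.ofReal_ne_top, ENNReal.ofReal_ofNat]
    congr 1
    exact lintegral_sub_left_eq_self (μ := (volume : Measure (EuclideanSpace ℝ (Fin 3))))
      (fun z => ENNReal.ofReal ((1 + ‖z‖ ^ 2) ^ (-(2 : ℝ)))) x
  calc ∫⁻ y, W y * g y = ∫⁻ y, g y * W y := lintegral_congr fun y => mul_comm _ _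
    _ ≤ (volume (ball (0 : EuclideanSpace ℝ (Fin 3)) 1))⁻¹ * (A * ∫⁻ z, w z) := h
    _ = _ := by rw [hint]

end Far

/-! ### Near/far splitting and the uniformly local Young and Hölder bounds -/

section NearFar

/-- **Near/far splitting of the envelope convolution.** Let `K(z) = c (σ + ‖z‖²)^{-2}`
(`c ≥ 0`, `σ ≥ 0`), `g` measurable with `∫_{B(z,1)} |g| ≤ A₁` for all `z`, and let `S ⊇ B(x,1)`
be measurable. Then
`∫ |K(y)| |g(x-y)| dy ≤ ∫ |K(y)| |(1_S g)(x-y)| dy + c · |B₁|⁻¹ · 25∫(1+|w|²)^{-2} · A₁`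
(for `‖y‖ < 1` the point `x - y` lies in `S`; for `‖y‖ ≥ 1` the far lemma applies). [folklore] -/
theorem lintegral_envelope_mul_le_near_add_far {c σ : ℝ} (hc : 0 ≤ c) (hσ : 0 ≤ σ)
    {g : EuclideanSpace ℝ (Fin 3) → ℝ} (hg : AEStronglyMeasurable g volume) {A₁ : ℝ≥0∞}
    (hA₁ : ∀ z : EuclideanSpace ℝ (Fin 3), ∫⁻ y in ball z 1, ‖g y‖ₑ ≤ A₁)
    (x : EuclideanSpace ℝ (Fin 3)) {S : Set (EuclideanSpace ℝ (Fin 3))}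
    (hxS : ball x 1 ⊆ S) :
    ∫⁻ y, ‖(fun z : EuclideanSpace ℝ (Fin 3) => c * (σ + ‖z‖ ^ 2) ^ (-(2 : ℝ))) y‖ₑ * ‖g (x - y)‖ₑ ≤
      (∫⁻ y, ‖(fun z : EuclideanSpace ℝ (Fin 3) => c * (σ + ‖z‖ ^ 2) ^ (-(2 : ℝ))) y‖ₑ *
          ‖S.indicator g (x - y)‖ₑ) +
        ENNReal.ofReal c * ((volume (ball (0 : EuclideanSpace ℝ (Fin 3)) 1))⁻¹ *
          (A₁ * (25 * ∫⁻ w : EuclideanSpace ℝ (Fin 3), ENNReal.ofReal ((1 + ‖w‖ ^ 2) ^ (-(2 : ℝ)))))) := by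
  set K : EuclideanSpace ℝ (Fin 3) → ℝ := fun z => c * (σ + ‖z‖ ^ 2) ^ (-(2 : ℝ)) with hK
  have hK0 : ∀ z, 0 ≤ K z := fun z => mul_nonneg hc (Real.rpow_nonneg (by positivity) _)
  have hKe : ∀ z, ‖K z‖ₑ = ENNReal.ofReal c * ENNReal.ofReal ((σ + ‖z‖ ^ 2) ^ (-(2 : ℝ))) := fun z => by
    rw [Real.enorm_eq_ofReal (hK0 z), hK, ENNReal.ofReal_mul hc]
  -- pointwise splitting of the integrand
  set W : EuclideanSpace ℝ (Fin 3) → ℝ≥0∞ :=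
    (ball x 1)ᶜ.indicator fun y => ENNReal.ofReal ((σ + ‖x - y‖ ^ 2) ^ (-(2 : ℝ))) with hW
  have hpt : ∀ y, ‖K y‖ₑ * ‖g (x - y)‖ₑ ≤
      ‖K y‖ₑ * ‖S.indicator g (x - y)‖ₑ + ENNReal.ofReal c * (W (x - y) * ‖g (x - y)‖ₑ) := by
    intro y
    by_cases hy : y ∈ ball (0 : EuclideanSpace ℝ (Fin 3)) 1
    · have hxy : x - y ∈ S := hxS (by
        rw [mem_ball, dist_eq_norm, sub_sub_cancel_left, norm_neg]
        rwa [mem_ball_zero_iff] at hy)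
      rw [indicator_of_mem hxy]
      exact le_self_add
    · have hfar : x - y ∈ (ball x 1)ᶜ := by
        rw [mem_compl_iff, mem_ball, dist_eq_norm, sub_sub_cancel_left, norm_neg]
        rwa [mem_ball_zero_iff] at hy
      have e : W (x - y) = ENNReal.ofReal ((σ + ‖y‖ ^ 2) ^ (-(2 : ℝ))) := by
        rw [hW, indicator_of_mem hfar, sub_sub_cancel]
      calc ‖K y‖ₑ * ‖g (x - y)‖ₑ = ENNReal.ofReal c * (W (x - y) * ‖g (x - y)‖ₑ) := by
            rw [hKe, e, mul_assoc]
        _ ≤ _ := le_add_self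
  -- integrate
  have hgm : AEMeasurable (fun y => ‖g y‖ₑ) volume := hg.enorm
  have hfar := lintegral_far_envelope_mul_le hgm hA₁ hσ x
  have hWm : AEMeasurable (fun y => W (x - y) * ‖g (x - y)‖ₑ) volume := by
    have h1 : AEMeasurable (fun y => W y * ‖g y‖ₑ) volume := by
      refine AEMeasurable.mul ?_ hgm
      refine (Measurable.indicator ?_ measurableSet_ball.compl).aemeasurable
      exact ((measurable_const.add ((measurable_const.sub measurable_id).norm.pow_const 2)).pow_const _).ennreal_ofReal
    exact h1.comp_quasiMeasurePreserving (quasiMeasurePreserving_sub_left_of_right_invariant volume x)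
  calc ∫⁻ y, ‖K y‖ₑ * ‖g (x - y)‖ₑ
      ≤ ∫⁻ y, (‖K y‖ₑ * ‖S.indicator g (x - y)‖ₑ + ENNReal.ofReal c * (W (x - y) * ‖g (x - y)‖ₑ)) :=
        lintegral_mono hpt
    _ = (∫⁻ y, ‖K y‖ₑ * ‖S.indicator g (x - y)‖ₑ) +
          ENNReal.ofReal c * ∫⁻ y, W (x - y) * ‖g (x - y)‖ₑ := by
        rw [lintegral_add_right' _ (hWm.const_mul _), lintegral_const_mul'' _ hWm]
    _ = (∫⁻ y, ‖K y‖ₑ * ‖S.indicator g (x - y)‖ₑ) + ENNReal.ofReal c * ∫⁻ y, W y * ‖g y‖ₑ := by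
        rw [lintegral_sub_left_eq_self (fun y => W y * ‖g y‖ₑ) x]
    _ ≤ _ := by gcongr

/-- **Uniformly local Young bound on unit balls.** Let `T` be dominated by the envelope
convolution, `‖T(x)‖ ≤ ∫ |K(y)| |g(x-y)| dy` with `K(z) = c (σ + ‖z‖²)^{-2}` (`c ≥ 0`, `σ ≥ 0`),
`g` measurable with `∫_{B(z,1)} |g| ≤ A₁` for all `z`, and `1 ≤ q < ∞`. Then for every centre
`x₀`, `‖T‖_{L^q(B(x₀,1))} ≤ ‖K‖₁ ‖g‖_{L^q(B(x₀,2))} + c C_far A₁ |B₁|^{1/q}` (Lemarié-Rieusset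
2016, p. 522, the near/far estimate of `φ₀(x-k)|W|`). [cite: LemarieRieusset2016, Thm. 14.8 proof Step 2, p. 522] -/
theorem eLpNorm_ball_le_of_dominated_envelope {F : Type*} [NormedAddCommGroup F]
    {c σ : ℝ} (hc : 0 ≤ c) (hσ : 0 ≤ σ)
    {g : EuclideanSpace ℝ (Fin 3) → ℝ} (hg : AEStronglyMeasurable g volume) {A₁ : ℝ≥0∞}
    (hA₁ : ∀ z : EuclideanSpace ℝ (Fin 3), ∫⁻ y in ball z 1, ‖g y‖ₑ ≤ A₁)
    {T : EuclideanSpace ℝ (Fin 3) → F}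
    (hT : ∀ x, ‖T x‖ₑ ≤
      ∫⁻ y, ‖(fun z : EuclideanSpace ℝ (Fin 3) => c * (σ + ‖z‖ ^ 2) ^ (-(2 : ℝ))) y‖ₑ * ‖g (x - y)‖ₑ)
    {q : ℝ≥0∞} (hq : 1 ≤ q) (hqtop : q ≠ ∞) (x₀ : EuclideanSpace ℝ (Fin 3)) :
    eLpNorm T q (volume.restrict (ball x₀ 1)) ≤
      (∫⁻ y, ‖(fun z : EuclideanSpace ℝ (Fin 3) => c * (σ + ‖z‖ ^ 2) ^ (-(2 : ℝ))) y‖ₑ) *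
          eLpNorm g q (volume.restrict (ball x₀ 2)) +
        ENNReal.ofReal c * ((volume (ball (0 : EuclideanSpace ℝ (Fin 3)) 1))⁻¹ *
          (A₁ * (25 * ∫⁻ w : EuclideanSpace ℝ (Fin 3), ENNReal.ofReal ((1 + ‖w‖ ^ 2) ^ (-(2 : ℝ)))))) *
          volume (ball x₀ 1) ^ (1 / q.toReal) := by
  set K : EuclideanSpace ℝ (Fin 3) → ℝ := fun z => c * (σ + ‖z‖ ^ 2) ^ (-(2 : ℝ)) with hK
  set Far : ℝ≥0∞ := ENNReal.ofReal c * ((volume (ball (0 : EuclideanSpace ℝ (Fin 3)) 1))⁻¹ *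
    (A₁ * (25 * ∫⁻ w : EuclideanSpace ℝ (Fin 3), ENNReal.ofReal ((1 + ‖w‖ ^ 2) ^ (-(2 : ℝ)))))) with hFar
  set g₂ : EuclideanSpace ℝ (Fin 3) → ℝ := (ball x₀ 2).indicator g with hg₂
  have hg₂m : AEStronglyMeasurable g₂ volume := hg.indicator measurableSet_ball
  set D₁ : EuclideanSpace ℝ (Fin 3) → ℝ≥0∞ := fun x => ∫⁻ y, ‖K y‖ₑ * ‖g₂ (x - y)‖ₑ with hD₁
  have hKm : AEStronglyMeasurable K volume :=
    (measurable_const.mul ((measurable_const.add (measurable_norm.pow_const 2)).pow_const _)).aestronglyMeasurable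
  have hq0 : q ≠ 0 := (zero_lt_one.trans_le hq).ne'
  have hq' : 1 ≤ q.toReal := by
    simpa using (ENNReal.toReal_le_toReal ENNReal.one_ne_top hqtop).2 hq
  have hq0' : 0 < q.toReal := one_pos.trans_le hq'
  -- the pointwise bound on the ball
  have hpt : ∀ x ∈ ball x₀ 1, ‖T x‖ₑ ≤ D₁ x + Far := by
    intro x hx
    have hxS : ball x 1 ⊆ ball x₀ 2 := by
      intro y hy
      rw [mem_ball] at hx hy ⊢
      linarith [dist_triangle y x x₀]
    exact (hT x).trans (lintegral_envelope_mul_le_near_add_far hc hσ hg hA₁ x hxS)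
  -- measurability of `D₁`
  have hD₁m : AEMeasurable D₁ volume := by
    have h : AEMeasurable (fun z : EuclideanSpace ℝ (Fin 3) × EuclideanSpace ℝ (Fin 3) =>
        ‖K z.2‖ₑ * ‖g₂ (z.1 - z.2)‖ₑ) (volume.prod volume) :=
      hKm.enorm.comp_snd.mul ((hg₂m.comp_quasiMeasurePreserving
        (quasiMeasurePreserving_sub_of_right_invariant volume volume)).enorm)
    exact h.lintegral_prod_right'
  -- Minkowski on the ball
  have hTq : eLpNorm T q (volume.restrict (ball x₀ 1)) =
      (∫⁻ x in ball x₀ 1, ‖T x‖ₑ ^ q.toReal) ^ (1 / q.toReal) :=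
    eLpNorm_eq_lintegral_rpow_enorm_toReal hq0 hqtop
  rw [hTq]
  calc (∫⁻ x in ball x₀ 1, ‖T x‖ₑ ^ q.toReal) ^ (1 / q.toReal)
      ≤ (∫⁻ x in ball x₀ 1, (D₁ x + Far) ^ q.toReal) ^ (1 / q.toReal) := by
        gcongr ?_ ^ _
        exact setLIntegral_mono' measurableSet_ball fun x hx => by gcongr; exact hpt x hx
    _ ≤ (∫⁻ x in ball x₀ 1, D₁ x ^ q.toReal) ^ (1 / q.toReal) +
          (∫⁻ x in ball x₀ 1, Far ^ q.toReal) ^ (1 / q.toReal) :=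
        ENNReal.lintegral_Lp_add_le hD₁m.restrict aemeasurable_const hq'
    _ ≤ (∫⁻ x, D₁ x ^ q.toReal) ^ (1 / q.toReal) + Far * volume (ball x₀ 1) ^ (1 / q.toReal) := by
        gcongr ?_ + ?_
        · gcongr ?_ ^ _
          exact setLIntegral_le_lintegral _ _
        · rw [setLIntegral_const, ENNReal.mul_rpow_of_nonneg _ _ (by positivity), ← ENNReal.rpow_mul,
            mul_one_div_cancel hq0'.ne', ENNReal.rpow_one]
    _ ≤ (∫⁻ y, ‖K y‖ₑ) * eLpNorm g₂ q volume + Far * volume (ball x₀ 1) ^ (1 / q.toReal) := by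
        gcongr ?_ + _
        exact rpow_lintegral_rpow_lintegral_mul_le hKm hg₂m hq hqtop
    _ = _ := by rw [hg₂, eLpNorm_indicator_eq_eLpNorm_restrict measurableSet_ball]

/-- **Pointwise Hölder bound with the far part summed over unit balls.** Let `T` be dominated by
the envelope convolution with `K(z) = c (σ + ‖z‖²)^{-2}` (`c ≥ 0`, `σ ≥ 0`) and `g` measurable with
`∫_{B(z,1)} |g| ≤ A₁` for all `z`; let `1/p + 1/p' = 1`. Then for every `x`,
`‖T(x)‖ ≤ ‖K‖_{L^p} ‖g‖_{L^{p'}(B(x,1))} + c C_far A₁` (Lemarié-Rieusset 2016, p. 522).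
[cite: LemarieRieusset2016, Thm. 14.8 proof Step 2, p. 522] -/
theorem enorm_le_of_dominated_envelope {F : Type*} [NormedAddCommGroup F]
    {c σ : ℝ} (hc : 0 ≤ c) (hσ : 0 ≤ σ)
    {g : EuclideanSpace ℝ (Fin 3) → ℝ} (hg : AEStronglyMeasurable g volume) {A₁ : ℝ≥0∞}
    (hA₁ : ∀ z : EuclideanSpace ℝ (Fin 3), ∫⁻ y in ball z 1, ‖g y‖ₑ ≤ A₁)
    {T : EuclideanSpace ℝ (Fin 3) → F}
    (hT : ∀ x, ‖T x‖ₑ ≤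
      ∫⁻ y, ‖(fun z : EuclideanSpace ℝ (Fin 3) => c * (σ + ‖z‖ ^ 2) ^ (-(2 : ℝ))) y‖ₑ * ‖g (x - y)‖ₑ)
    (p p' : ℝ≥0∞) [p.HolderConjugate p'] (x : EuclideanSpace ℝ (Fin 3)) :
    ‖T x‖ₑ ≤
      eLpNorm (fun z : EuclideanSpace ℝ (Fin 3) => c * (σ + ‖z‖ ^ 2) ^ (-(2 : ℝ))) p volume *
          eLpNorm g p' (volume.restrict (ball x 1)) +
        ENNReal.ofReal c * ((volume (ball (0 : EuclideanSpace ℝ (Fin 3)) 1))⁻¹ *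
          (A₁ * (25 * ∫⁻ w : EuclideanSpace ℝ (Fin 3), ENNReal.ofReal ((1 + ‖w‖ ^ 2) ^ (-(2 : ℝ)))))) := by
  set K : EuclideanSpace ℝ (Fin 3) → ℝ := fun z => c * (σ + ‖z‖ ^ 2) ^ (-(2 : ℝ)) with hK
  set g₁ : EuclideanSpace ℝ (Fin 3) → ℝ := (ball x 1).indicator g with hg₁
  have hg₁m : AEStronglyMeasurable g₁ volume := hg.indicator measurableSet_ball
  have hKm : AEStronglyMeasurable K volume :=
    (measurable_const.mul ((measurable_const.add (measurable_norm.pow_const 2)).pow_const _)).aestronglyMeasurable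
  have hmp : MeasurePreserving (fun y : EuclideanSpace ℝ (Fin 3) => x - y) volume volume :=
    Measure.measurePreserving_sub_left volume x
  have hsh : AEStronglyMeasurable (fun y => g₁ (x - y)) volume := hg₁m.comp_measurePreserving hmp
  calc ‖T x‖ₑ ≤ (∫⁻ y, ‖K y‖ₑ * ‖g₁ (x - y)‖ₑ) + _ :=
        (hT x).trans (lintegral_envelope_mul_le_near_add_far hc hσ hg hA₁ x subset_rfl)
    _ ≤ eLpNorm K p volume * eLpNorm g p' (volume.restrict (ball x 1)) + _ := by
        gcongr ?_ + _
        calc ∫⁻ y, ‖K y‖ₑ * ‖g₁ (x - y)‖ₑ = eLpNorm (K • fun y => g₁ (x - y)) 1 volume := by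
              rw [eLpNorm_one_eq_lintegral_enorm]
              simp_rw [Pi.smul_apply', enorm_smul]
          _ ≤ eLpNorm K p volume * eLpNorm (fun y => g₁ (x - y)) p' volume :=
              eLpNorm_smul_le_mul_eLpNorm hsh hKm
          _ = eLpNorm K p volume * eLpNorm g₁ p' volume := by
              rw [show (fun y => g₁ (x - y)) = g₁ ∘ (fun y => x - y) from rfl,
                eLpNorm_comp_measurePreserving hg₁m hmp]
          _ = eLpNorm K p volume * eLpNorm g p' (volume.restrict (ball x 1)) := by
              rw [hg₁, eLpNorm_indicator_eq_eLpNorm_restrict measurableSet_ball]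

/-- **From unit balls to the doubled ball**: if `∫_{B(z,1)} |g|^q ≤ L^q`-type bounds hold in
the form `eLpNorm g q (B(z,1)) ≤ L` for all centres, then
`eLpNorm g q (B(x₀,2)) ≤ (|B₁|⁻¹ |B₃|)^{1/q} L`, `1 ≤ q < ∞` (the averaging lemma
`setLIntegral_ball_le_of_forall_unitBall` applied to `|g|^q`). [folklore] -/
theorem eLpNorm_ball_two_le_of_forall_unitBall {F : Type*} [NormedAddCommGroup F]
    {g : EuclideanSpace ℝ (Fin 3) → F} (hg : AEStronglyMeasurable g volume)
    {q : ℝ≥0∞} (hq : 1 ≤ q) (hqtop : q ≠ ∞) {L : ℝ≥0∞}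
    (hL : ∀ z : EuclideanSpace ℝ (Fin 3), eLpNorm g q (volume.restrict (ball z 1)) ≤ L)
    (x₀ : EuclideanSpace ℝ (Fin 3)) :
    eLpNorm g q (volume.restrict (ball x₀ 2)) ≤
      ((volume (ball (0 : EuclideanSpace ℝ (Fin 3)) 1))⁻¹ *
        volume (ball (0 : EuclideanSpace ℝ (Fin 3)) 3)) ^ (1 / q.toReal) * L := by
  have hq0 : q ≠ 0 := (zero_lt_one.trans_le hq).ne'
  have hq' : 1 ≤ q.toReal := by
    simpa using (ENNReal.toReal_le_toReal ENNReal.one_ne_top hqtop).2 hq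
  have hq0' : 0 < q.toReal := one_pos.trans_le hq'
  set G : EuclideanSpace ℝ (Fin 3) → ℝ≥0∞ := fun y => ‖g y‖ₑ ^ q.toReal with hG
  have hGm : AEMeasurable G volume := hg.enorm.pow_const _
  have hball : ∀ z, ∫⁻ y in ball z 1, G y ≤ L ^ q.toReal := fun z => by
    have h := hL z
    rw [eLpNorm_eq_lintegral_rpow_enorm_toReal hq0 hqtop] at h
    have h2 := ENNReal.rpow_le_rpow h hq0'.le
    rwa [← ENNReal.rpow_mul, one_div_mul_cancel hq0'.ne', ENNReal.rpow_one] at h2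
  have h := setLIntegral_ball_le_of_forall_unitBall hGm hball x₀ 2
  rw [show (2 : ℝ) + 1 = 3 by norm_num] at h
  rw [eLpNorm_eq_lintegral_rpow_enorm_toReal hq0 hqtop]
  calc (∫⁻ y in ball x₀ 2, ‖g y‖ₑ ^ q.toReal) ^ (1 / q.toReal)
      ≤ ((volume (ball (0 : EuclideanSpace ℝ (Fin 3)) 1))⁻¹ *
          (L ^ q.toReal * volume (ball (0 : EuclideanSpace ℝ (Fin 3)) 3))) ^ (1 / q.toReal) :=
        ENNReal.rpow_le_rpow h (by positivity)
    _ = _ := by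
        have e : (volume (ball (0 : EuclideanSpace ℝ (Fin 3)) 1))⁻¹ *
            (L ^ q.toReal * volume (ball (0 : EuclideanSpace ℝ (Fin 3)) 3)) =
            ((volume (ball (0 : EuclideanSpace ℝ (Fin 3)) 1))⁻¹ * volume (ball (0 : EuclideanSpace ℝ (Fin 3)) 3)) *
              L ^ q.toReal := by ring
        rw [e, ENNReal.mul_rpow_of_nonneg _ _ (by positivity), ← ENNReal.rpow_mul,
          mul_one_div_cancel hq0'.ne', ENNReal.rpow_one]

/-- **From unit balls to unit balls, `L¹` from `L^q`**: `∫_{B(z,1)} |g| ≤ |B₁|^{1 - 1/q} ‖g‖_{L^q(B(z,1))}`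
(Hölder on the finite measure `|B₁|`), `1 ≤ q`. [folklore] -/
theorem lintegral_ball_enorm_le_mul_eLpNorm {F : Type*} [NormedAddCommGroup F]
    {g : EuclideanSpace ℝ (Fin 3) → F} (hg : AEStronglyMeasurable g volume)
    {q : ℝ≥0∞} (hq : 1 ≤ q) (z : EuclideanSpace ℝ (Fin 3)) :
    ∫⁻ y in ball z 1, ‖g y‖ₑ ≤
      volume (ball (0 : EuclideanSpace ℝ (Fin 3)) 1) ^ (1 - 1 / q.toReal) *
        eLpNorm g q (volume.restrict (ball z 1)) := by
  have h := eLpNorm_le_eLpNorm_mul_rpow_measure_univ (μ := volume.restrict (ball z 1)) hq hg.restrict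
  rw [eLpNorm_one_eq_lintegral_enorm, Measure.restrict_apply_univ, Measure.addHaar_ball_center,
    ENNReal.toReal_one] at h
  calc ∫⁻ y in ball z 1, ‖g y‖ₑ
      ≤ eLpNorm g q (volume.restrict (ball z 1)) *
          volume (ball (0 : EuclideanSpace ℝ (Fin 3)) 1) ^ (1 / 1 - 1 / q.toReal) := h
    _ = _ := by rw [div_one, mul_comm]

end NearFar

/-! ### Sizes of the envelope in `ℝ³` -/

section EnvelopeSizes

/-- **`L¹` size of the envelope in `ℝ³`**: `∫ c (σ + ‖z‖²)^{-2} dz = c σ^{-1/2} ∫ (1 + ‖w‖²)^{-2} dw`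
(`c ≥ 0`, `σ > 0`). [folklore] -/
theorem lintegral_enorm_envelope_three {c σ : ℝ} (hc : 0 ≤ c) (hσ : 0 < σ) :
    ∫⁻ z : EuclideanSpace ℝ (Fin 3), ‖(fun z : EuclideanSpace ℝ (Fin 3) => c * (σ + ‖z‖ ^ 2) ^ (-(2 : ℝ))) z‖ₑ =
      ENNReal.ofReal (c * (σ ^ (-(1 / 2 : ℝ)) *
        ∫ w : EuclideanSpace ℝ (Fin 3), (1 + ‖w‖ ^ 2) ^ (-(2 : ℝ)))) := by
  have h := lintegral_enorm_oseenEnvelope (E := EuclideanSpace ℝ (Fin 3)) hc hσ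
  simp only [oseen_exponent_eq_two] at h
  exact h

/-- **`Lʳ` size of the envelope in `ℝ³`**, `1 ≤ r < ∞`: there is `C_r ≥ 0` with
`‖z ↦ c (σ + ‖z‖²)^{-2}‖_{Lʳ} ≤ C_r σ^{3/(2r) - 2}` for all `σ > 0`. [folklore] -/
theorem exists_eLpNorm_envelope_three_le {c : ℝ} (hc : 0 ≤ c) {r : ℝ≥0∞} (hr1 : 1 ≤ r)
    (hr : r ≠ ∞) :
    ∃ Cr : ℝ, 0 ≤ Cr ∧ ∀ σ : ℝ, 0 < σ →
      eLpNorm (fun z : EuclideanSpace ℝ (Fin 3) => c * (σ + ‖z‖ ^ 2) ^ (-(2 : ℝ))) r volume ≤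
        ENNReal.ofReal (Cr * σ ^ (3 / (2 * r.toReal) - 2)) := by
  obtain ⟨Cr, hCr, h⟩ := exists_eLpNorm_oseenEnvelope_le (E := EuclideanSpace ℝ (Fin 3)) hc hr1 hr
  refine ⟨Cr, hCr, fun σ hσ => ?_⟩
  have h' := h σ hσ
  simp only [oseen_exponent_eq_two] at h'
  simp only [finrank_real_euclideanSpace_fin_three] at h'
  exact h'

/-- The far constant `C_far = |B₁|⁻¹ · 25 ∫ (1 + ‖w‖²)^{-2} dw` is finite. [folklore] -/
theorem ulocFarConst_lt_top :
    (volume (ball (0 : EuclideanSpace ℝ (Fin 3)) 1))⁻¹ *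
        (25 * ∫⁻ w : EuclideanSpace ℝ (Fin 3), ENNReal.ofReal ((1 + ‖w‖ ^ 2) ^ (-(2 : ℝ)))) < ∞ := by
  refine ENNReal.mul_lt_top ?_ (ENNReal.mul_lt_top (by norm_num) lintegral_one_add_norm_sq_rpow_neg_two_lt_top)
  exact ENNReal.inv_lt_top.2 (measure_ball_pos volume _ one_pos)

/-- Rearranging the far term: `|B₁|⁻¹ (A (25 I)) = (|B₁|⁻¹ (25 I)) A`. [folklore] -/
theorem ulocFarTerm_eq (A : ℝ≥0∞) :
    (volume (ball (0 : EuclideanSpace ℝ (Fin 3)) 1))⁻¹ *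
        (A * (25 * ∫⁻ w : EuclideanSpace ℝ (Fin 3), ENNReal.ofReal ((1 + ‖w‖ ^ 2) ^ (-(2 : ℝ))))) =
      (volume (ball (0 : EuclideanSpace ℝ (Fin 3)) 1))⁻¹ *
        (25 * ∫⁻ w : EuclideanSpace ℝ (Fin 3), ENNReal.ofReal ((1 + ‖w‖ ^ 2) ^ (-(2 : ℝ)))) * A := by
  ring

end EnvelopeSizes

/-! ### The Oseen–Koch–Tataru slices on unit balls -/

section OseenSlice

/-- `‖ |a| |b| ‖ₑ = ‖a‖ₑ ‖b‖ₑ` pointwise. [folklore] -/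
theorem enorm_norm_mul_norm {F : Type*} [NormedAddCommGroup F] (a b : F) :
    ‖(‖a‖ * ‖b‖)‖ₑ = ‖a‖ₑ * ‖b‖ₑ := by
  rw [Real.enorm_eq_ofReal (by positivity), ENNReal.ofReal_mul (norm_nonneg _), ofReal_norm, ofReal_norm]

/-- **The Oseen slice on a unit ball, uniformly local Young** (Lemarié-Rieusset 2016, p. 523,
"`‖B(v,w)(t)‖_{E³} ≤ C∫(t-s)^{-1/2}‖v ⊗ w‖ …`", slice-wise): with the kernel bound (14) in the form
`‖K(τ,z)[p,q]‖ ≤ C (τ + ‖z‖²)^{-2} ‖p‖ ‖q‖` on `ℝ³`, for `σ > 0`, measurable `a`, `b` with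
`∫_{B(z,1)} |a||b| ≤ A₁` for all `z`, `1 ≤ q < ∞` and every centre `x₀`:
`‖T_σ[a,b]‖_{L^q(B(x₀,1))} ≤ C σ^{-1/2} I ‖|a||b|‖_{L^q(B(x₀,2))} + C C_far A₁ |B₁|^{1/q}`.
[cite: LemarieRieusset2016, Thm. 14.8 proof Step 2, p. 523] -/
theorem eLpNorm_ball_oseenSlice_le {C : ℝ} (hC : 0 ≤ C)
    (hK : ∀ {τ : ℝ}, 0 < τ → ∀ z p q : EuclideanSpace ℝ (Fin 3), ‖oseenKernel τ z p q‖ ≤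
      C * (τ + ‖z‖ ^ 2) ^ (-(((Module.finrank ℝ (EuclideanSpace ℝ (Fin 3)) : ℝ) + 1) / 2)) * ‖p‖ * ‖q‖)
    {σ : ℝ} (hσ : 0 < σ) {a b : EuclideanSpace ℝ (Fin 3) → EuclideanSpace ℝ (Fin 3)}
    (ha : AEStronglyMeasurable a volume) (hb : AEStronglyMeasurable b volume) {A₁ : ℝ≥0∞}
    (hA₁ : ∀ z : EuclideanSpace ℝ (Fin 3), ∫⁻ y in ball z 1, ‖a y‖ₑ * ‖b y‖ₑ ≤ A₁)
    {q : ℝ≥0∞} (hq : 1 ≤ q) (hqtop : q ≠ ∞) (x₀ : EuclideanSpace ℝ (Fin 3)) :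
    eLpNorm (fun x => ∫ y, oseenKernel σ (x - y) (a y) (b y)) q (volume.restrict (ball x₀ 1)) ≤
      ENNReal.ofReal (C * (σ ^ (-(1 / 2 : ℝ)) *
          ∫ w : EuclideanSpace ℝ (Fin 3), (1 + ‖w‖ ^ 2) ^ (-(2 : ℝ)))) *
          eLpNorm (fun y => ‖a y‖ * ‖b y‖) q (volume.restrict (ball x₀ 2)) +
        ENNReal.ofReal C * ((volume (ball (0 : EuclideanSpace ℝ (Fin 3)) 1))⁻¹ *
          (A₁ * (25 * ∫⁻ w : EuclideanSpace ℝ (Fin 3), ENNReal.ofReal ((1 + ‖w‖ ^ 2) ^ (-(2 : ℝ)))))) *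
          volume (ball x₀ 1) ^ (1 / q.toReal) := by
  set g : EuclideanSpace ℝ (Fin 3) → ℝ := fun y => ‖a y‖ * ‖b y‖ with hg
  have hgm : AEStronglyMeasurable g volume := ha.norm.mul hb.norm
  have hA₁' : ∀ z : EuclideanSpace ℝ (Fin 3), ∫⁻ y in ball z 1, ‖g y‖ₑ ≤ A₁ := fun z => by
    simp_rw [hg, enorm_norm_mul_norm]; exact hA₁ z
  have hdom : ∀ x, ‖∫ y, oseenKernel σ (x - y) (a y) (b y)‖ₑ ≤
      ∫⁻ y, ‖(fun z : EuclideanSpace ℝ (Fin 3) => C * (σ + ‖z‖ ^ 2) ^ (-(2 : ℝ))) y‖ₑ * ‖g (x - y)‖ₑ := by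
    intro x
    have h := enorm_oseenSlice_le_lintegral hC hK hσ a b x
    simp only [oseen_exponent_eq_two] at h
    exact h
  have h := eLpNorm_ball_le_of_dominated_envelope hC hσ.le hgm hA₁' hdom hq hqtop x₀
  rwa [lintegral_enorm_envelope_three hC hσ] at h

/-- **The Oseen slice at a point, uniformly local Hölder** (Lemarié-Rieusset 2016, p. 523,
"`‖B(v,w)(t)‖_∞ ≤ C∫(t-s)^{-3/4}‖v‖_{L⁶_uloc}‖w‖_∞`", slice-wise): with the kernel bound (14), for
`σ > 0`, measurable `a`, `b` with `∫_{B(z,1)} |a||b| ≤ A₁` for all `z`, `1/p + 1/p' = 1` and every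
`x`: `‖T_σ[a,b](x)‖ ≤ ‖Env_σ‖_{L^p} ‖|a||b|‖_{L^{p'}(B(x,1))} + C C_far A₁`.
[cite: LemarieRieusset2016, Thm. 14.8 proof Step 2, p. 523] -/
theorem enorm_oseenSlice_le_uloc {C : ℝ} (hC : 0 ≤ C)
    (hK : ∀ {τ : ℝ}, 0 < τ → ∀ z p q : EuclideanSpace ℝ (Fin 3), ‖oseenKernel τ z p q‖ ≤
      C * (τ + ‖z‖ ^ 2) ^ (-(((Module.finrank ℝ (EuclideanSpace ℝ (Fin 3)) : ℝ) + 1) / 2)) * ‖p‖ * ‖q‖)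
    {σ : ℝ} (hσ : 0 < σ) {a b : EuclideanSpace ℝ (Fin 3) → EuclideanSpace ℝ (Fin 3)}
    (ha : AEStronglyMeasurable a volume) (hb : AEStronglyMeasurable b volume) {A₁ : ℝ≥0∞}
    (hA₁ : ∀ z : EuclideanSpace ℝ (Fin 3), ∫⁻ y in ball z 1, ‖a y‖ₑ * ‖b y‖ₑ ≤ A₁)
    (p p' : ℝ≥0∞) [p.HolderConjugate p'] (x : EuclideanSpace ℝ (Fin 3)) :
    ‖∫ y, oseenKernel σ (x - y) (a y) (b y)‖ₑ ≤
      eLpNorm (fun z : EuclideanSpace ℝ (Fin 3) => C * (σ + ‖z‖ ^ 2) ^ (-(2 : ℝ))) p volume *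
          eLpNorm (fun y => ‖a y‖ * ‖b y‖) p' (volume.restrict (ball x 1)) +
        ENNReal.ofReal C * ((volume (ball (0 : EuclideanSpace ℝ (Fin 3)) 1))⁻¹ *
          (A₁ * (25 * ∫⁻ w : EuclideanSpace ℝ (Fin 3), ENNReal.ofReal ((1 + ‖w‖ ^ 2) ^ (-(2 : ℝ)))))) := by
  set g : EuclideanSpace ℝ (Fin 3) → ℝ := fun y => ‖a y‖ * ‖b y‖ with hg
  have hgm : AEStronglyMeasurable g volume := ha.norm.mul hb.norm
  have hA₁' : ∀ z : EuclideanSpace ℝ (Fin 3), ∫⁻ y in ball z 1, ‖g y‖ₑ ≤ A₁ := fun z => by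
    simp_rw [hg, enorm_norm_mul_norm]; exact hA₁ z
  have hdom : ∀ x, ‖∫ y, oseenKernel σ (x - y) (a y) (b y)‖ₑ ≤
      ∫⁻ y, ‖(fun z : EuclideanSpace ℝ (Fin 3) => C * (σ + ‖z‖ ^ 2) ^ (-(2 : ℝ))) y‖ₑ * ‖g (x - y)‖ₑ := by
    intro x
    have h := enorm_oseenSlice_le_lintegral hC hK hσ a b x
    simp only [oseen_exponent_eq_two] at h
    exact h
  exact enorm_le_of_dominated_envelope hC hσ.le hgm hA₁' hdom p p' x

end OseenSlice

/-! ### The heat extension on unit balls -/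

section Heat

/-- **The heat kernel under the Oseen envelope in `ℝ³`**: there is `C_h > 0` with
`G_s(z) ≤ C_h s^{1/2} (s + ‖z‖²)^{-2}` for all `s > 0`, `z ∈ ℝ³` (`exists_heatKernel_le_rpow` with
`e = 2`). [folklore] -/
theorem exists_heatKernel_le_envelope_three :
    ∃ Ch : ℝ, 0 < Ch ∧ ∀ {s : ℝ}, 0 < s → ∀ z : EuclideanSpace ℝ (Fin 3),
      UnboundedOperators.heatKernel s z ≤ Ch * s ^ (1 / 2 : ℝ) * (s + ‖z‖ ^ 2) ^ (-(2 : ℝ)) := by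
  obtain ⟨C, hC, h⟩ := exists_heatKernel_le_rpow (E := EuclideanSpace ℝ (Fin 3)) 2
  refine ⟨C, hC, fun {s} hs z => ?_⟩
  have h' := h hs z
  rw [finrank_real_euclideanSpace_fin_three] at h'
  convert h' using 2
  norm_num

/-- **Pointwise domination of the heat extension by the envelope convolution**: with `C_h` as
above, `‖e^{sΔ}f(x)‖ ≤ ∫ (C_h s^{1/2}) (s + ‖y‖²)^{-2} |f(x-y)| dy` for `s > 0`. [folklore] -/
theorem enorm_heatExtension_le_lintegral_envelope {F : Type*} [NormedAddCommGroup F]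
    [NormedSpace ℝ F] {Ch : ℝ} (hCh : 0 ≤ Ch)
    (hG : ∀ {s : ℝ}, 0 < s → ∀ z : EuclideanSpace ℝ (Fin 3),
      UnboundedOperators.heatKernel s z ≤ Ch * s ^ (1 / 2 : ℝ) * (s + ‖z‖ ^ 2) ^ (-(2 : ℝ)))
    {s : ℝ} (hs : 0 < s) (f : EuclideanSpace ℝ (Fin 3) → F) (x : EuclideanSpace ℝ (Fin 3)) :
    ‖UnboundedOperators.heatExtension f s x‖ₑ ≤
      ∫⁻ y, ‖(fun z : EuclideanSpace ℝ (Fin 3) => (Ch * s ^ (1 / 2 : ℝ)) * (s + ‖z‖ ^ 2) ^ (-(2 : ℝ))) y‖ₑ *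
        ‖f (x - y)‖ₑ := by
  rw [UnboundedOperators.heatExtension_apply]
  refine (enorm_integral_le_lintegral_enorm _).trans (lintegral_mono fun y => ?_)
  rw [enorm_smul]
  gcongr
  have h0 : 0 ≤ UnboundedOperators.heatKernel s y := (UnboundedOperators.heatKernel_pos hs y).le
  rw [Real.enorm_eq_ofReal h0, Real.enorm_eq_ofReal (by
    exact mul_nonneg (mul_nonneg hCh (Real.rpow_nonneg hs.le _)) (Real.rpow_nonneg (by positivity) _))]
  exact ENNReal.ofReal_le_ofReal (hG hs y)

/-- **The heat extension on a unit ball, uniformly local Young** (Lemarié-Rieusset 2016, p. 521: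
"`sup_{0<τ<1} ‖e^{ντΔ}u‖_{L³_uloc} ≤ ‖u‖_{L³_uloc}`", up to constants): for `s > 0`, measurable `f`
with `∫_{B(z,1)} |f| ≤ A₁` for all `z`, `1 ≤ q < ∞` and every centre `x₀`,
`‖e^{sΔ}f‖_{L^q(B(x₀,1))} ≤ C_h I ‖f‖_{L^q(B(x₀,2))} + C_h s^{1/2} C_far A₁ |B₁|^{1/q}`.
[cite: LemarieRieusset2016, Thm. 14.8 proof Step 2, p. 521] -/
theorem eLpNorm_ball_heatExtension_le {F : Type*} [NormedAddCommGroup F] [NormedSpace ℝ F]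
    {Ch : ℝ} (hCh : 0 ≤ Ch)
    (hG : ∀ {s : ℝ}, 0 < s → ∀ z : EuclideanSpace ℝ (Fin 3),
      UnboundedOperators.heatKernel s z ≤ Ch * s ^ (1 / 2 : ℝ) * (s + ‖z‖ ^ 2) ^ (-(2 : ℝ)))
    {s : ℝ} (hs : 0 < s) {f : EuclideanSpace ℝ (Fin 3) → F} (hf : AEStronglyMeasurable f volume)
    {A₁ : ℝ≥0∞} (hA₁ : ∀ z : EuclideanSpace ℝ (Fin 3), ∫⁻ y in ball z 1, ‖f y‖ₑ ≤ A₁)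
    {q : ℝ≥0∞} (hq : 1 ≤ q) (hqtop : q ≠ ∞) (x₀ : EuclideanSpace ℝ (Fin 3)) :
    eLpNorm (UnboundedOperators.heatExtension f s) q (volume.restrict (ball x₀ 1)) ≤
      ENNReal.ofReal (Ch * ∫ w : EuclideanSpace ℝ (Fin 3), (1 + ‖w‖ ^ 2) ^ (-(2 : ℝ))) *
          eLpNorm f q (volume.restrict (ball x₀ 2)) +
        ENNReal.ofReal (Ch * s ^ (1 / 2 : ℝ)) * ((volume (ball (0 : EuclideanSpace ℝ (Fin 3)) 1))⁻¹ *
          (A₁ * (25 * ∫⁻ w : EuclideanSpace ℝ (Fin 3), ENNReal.ofReal ((1 + ‖w‖ ^ 2) ^ (-(2 : ℝ)))))) *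
          volume (ball x₀ 1) ^ (1 / q.toReal) := by
  set g : EuclideanSpace ℝ (Fin 3) → ℝ := fun y => ‖f y‖ with hg
  have hgm : AEStronglyMeasurable g volume := hf.norm
  have hge : ∀ y, ‖g y‖ₑ = ‖f y‖ₑ := fun y => by rw [hg, enorm_norm]
  have hA₁' : ∀ z : EuclideanSpace ℝ (Fin 3), ∫⁻ y in ball z 1, ‖g y‖ₑ ≤ A₁ := fun z => by
    simp_rw [hge]; exact hA₁ z
  have hc : 0 ≤ Ch * s ^ (1 / 2 : ℝ) := mul_nonneg hCh (Real.rpow_nonneg hs.le _)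
  have hdom : ∀ x, ‖UnboundedOperators.heatExtension f s x‖ₑ ≤
      ∫⁻ y, ‖(fun z : EuclideanSpace ℝ (Fin 3) => (Ch * s ^ (1 / 2 : ℝ)) * (s + ‖z‖ ^ 2) ^ (-(2 : ℝ))) y‖ₑ *
        ‖g (x - y)‖ₑ := by
    intro x
    have h := enorm_heatExtension_le_lintegral_envelope hCh hG hs f x
    simp_rw [hge]
    exact h
  have h := eLpNorm_ball_le_of_dominated_envelope hc hs.le hgm hA₁' hdom hq hqtop x₀
  rw [lintegral_enorm_envelope_three hc hs] at h
  have hnorm : eLpNorm g q (volume.restrict (ball x₀ 2)) = eLpNorm f q (volume.restrict (ball x₀ 2)) := by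
    rw [hg, eLpNorm_norm]
  rw [hnorm] at h
  refine h.trans (add_le_add ?_ le_rfl)
  refine mul_le_mul' (le_of_eq ?_) le_rfl
  congr 1
  rw [mul_assoc Ch, ← mul_assoc (s ^ (1 / 2 : ℝ)), ← Real.rpow_add hs]
  norm_num

/-- **The heat extension at a point, uniformly local Hölder** (Lemarié-Rieusset 2016, p. 522:
"`sup_{0<τ<1} √τ ‖e^{ντΔ}u‖_∞ ≤ C_ν ‖u‖_{L³_uloc}`", from the `L^{3/2}` size `∝ s^{-1}` of the
envelope): for `s > 0`, measurable `f` with `∫_{B(z,1)} |f| ≤ A₁`, `1/p + 1/p' = 1` and every `x`,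
`‖e^{sΔ}f(x)‖ ≤ ‖(C_h s^{1/2}) Env_s‖_{L^p} ‖f‖_{L^{p'}(B(x,1))} + C_h s^{1/2} C_far A₁`.
[cite: LemarieRieusset2016, Thm. 14.8 proof Step 2, p. 522] -/
theorem enorm_heatExtension_le_uloc {F : Type*} [NormedAddCommGroup F] [NormedSpace ℝ F]
    {Ch : ℝ} (hCh : 0 ≤ Ch)
    (hG : ∀ {s : ℝ}, 0 < s → ∀ z : EuclideanSpace ℝ (Fin 3),
      UnboundedOperators.heatKernel s z ≤ Ch * s ^ (1 / 2 : ℝ) * (s + ‖z‖ ^ 2) ^ (-(2 : ℝ)))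
    {s : ℝ} (hs : 0 < s) {f : EuclideanSpace ℝ (Fin 3) → F} (hf : AEStronglyMeasurable f volume)
    {A₁ : ℝ≥0∞} (hA₁ : ∀ z : EuclideanSpace ℝ (Fin 3), ∫⁻ y in ball z 1, ‖f y‖ₑ ≤ A₁)
    (p p' : ℝ≥0∞) [p.HolderConjugate p'] (x : EuclideanSpace ℝ (Fin 3)) :
    ‖UnboundedOperators.heatExtension f s x‖ₑ ≤
      eLpNorm (fun z : EuclideanSpace ℝ (Fin 3) => (Ch * s ^ (1 / 2 : ℝ)) * (s + ‖z‖ ^ 2) ^ (-(2 : ℝ))) p volume *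
          eLpNorm f p' (volume.restrict (ball x 1)) +
        ENNReal.ofReal (Ch * s ^ (1 / 2 : ℝ)) * ((volume (ball (0 : EuclideanSpace ℝ (Fin 3)) 1))⁻¹ *
          (A₁ * (25 * ∫⁻ w : EuclideanSpace ℝ (Fin 3), ENNReal.ofReal ((1 + ‖w‖ ^ 2) ^ (-(2 : ℝ)))))) := by
  set g : EuclideanSpace ℝ (Fin 3) → ℝ := fun y => ‖f y‖ with hg
  have hgm : AEStronglyMeasurable g volume := hf.norm
  have hge : ∀ y, ‖g y‖ₑ = ‖f y‖ₑ := fun y => by rw [hg, enorm_norm]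
  have hA₁' : ∀ z : EuclideanSpace ℝ (Fin 3), ∫⁻ y in ball z 1, ‖g y‖ₑ ≤ A₁ := fun z => by
    simp_rw [hge]; exact hA₁ z
  have hc : 0 ≤ Ch * s ^ (1 / 2 : ℝ) := mul_nonneg hCh (Real.rpow_nonneg hs.le _)
  have hdom : ∀ x, ‖UnboundedOperators.heatExtension f s x‖ₑ ≤
      ∫⁻ y, ‖(fun z : EuclideanSpace ℝ (Fin 3) => (Ch * s ^ (1 / 2 : ℝ)) * (s + ‖z‖ ^ 2) ^ (-(2 : ℝ))) y‖ₑ *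
        ‖g (x - y)‖ₑ := by
    intro x
    have h := enorm_heatExtension_le_lintegral_envelope hCh hG hs f x
    simp_rw [hge]
    exact h
  have h := enorm_le_of_dominated_envelope hc hs.le hgm hA₁' hdom p p' x
  have hnorm : eLpNorm g p' (volume.restrict (ball x 1)) = eLpNorm f p' (volume.restrict (ball x 1)) := by
    rw [hg, eLpNorm_norm]
  rwa [hnorm] at h

end Heat

/-! ### Hölder pairs -/

section HolderPairs

/-- `1/(3/2) + 1/3 = 1`. [folklore] -/
theorem ulocHolderConjugate_threeHalves_three : ENNReal.HolderConjugate (3 / 2) 3 := by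
  refine ⟨?_⟩
  have h32 : (3 / 2 : ℝ≥0∞) = ENNReal.ofReal (3 / 2) := by
    rw [ENNReal.ofReal_div_of_pos (by norm_num), ENNReal.ofReal_ofNat, ENNReal.ofReal_ofNat]
  have h : ENNReal.ofReal (3 / 2)⁻¹ + ENNReal.ofReal 3⁻¹ = 1 := by
    rw [← ENNReal.ofReal_add (by positivity) (by positivity), ← ENNReal.ofReal_one]
    norm_num
  rw [h32, inv_one, ← h, ENNReal.ofReal_inv_of_pos (by norm_num), ENNReal.ofReal_inv_of_pos (by norm_num),
    ENNReal.ofReal_ofNat]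

end HolderPairs

/-! ### The Duhamel term `B(u,v)(t) = ∫₀ᵗ e^{(t-τ)Δ}P∇·(u ⊗ v) dτ` in the uniformly local weighted class -/

section Duhamel

/-- **Weighted pointwise bound of the Duhamel term** (Lemarié-Rieusset 2016, p. 523:
`‖B(v,w)(t)‖_∞ ≤ C∫(t-s)^{-3/4}‖v‖_{L⁶_uloc}‖w‖_∞ ds ≤ C' t^{-1/2} sup s^{1/4}‖v‖_{L⁶_uloc} sup √s‖w‖_∞`,
plus the far part, bounded by the uniformly local `L¹` size of `|u||v|`). Unit viscosity, initial
time `0`: if `‖u(τ)‖_{L⁶(B(z,1))} ≤ Z τ^{-1/4}`, `‖v(τ,y)‖ ≤ Y τ^{-1/2}` and `∫_{B(z,1)} |u(τ)||v(τ)| ≤ A`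
on `(0,T)`, then for `0 < t ≤ T` and every `x`,
`‖B(u,v)(t,x)‖ ≤ 16 C₆₅ Z Y t^{-1/2} + C₀ C_far A t`. [cite: LemarieRieusset2016, Thm. 14.8 proof Step 2, p. 523] -/
theorem enorm_oseenDuhamel_le_uloc_weighted {C₀ : ℝ} (hC₀ : 0 ≤ C₀)
    (hK : ∀ {τ : ℝ}, 0 < τ → ∀ z p q : EuclideanSpace ℝ (Fin 3), ‖oseenKernel τ z p q‖ ≤
      C₀ * (τ + ‖z‖ ^ 2) ^ (-(((Module.finrank ℝ (EuclideanSpace ℝ (Fin 3)) : ℝ) + 1) / 2)) * ‖p‖ * ‖q‖)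
    {C₆₅ : ℝ} (hC₆₅ : 0 ≤ C₆₅)
    (hE : ∀ σ : ℝ, 0 < σ →
      eLpNorm (fun z : EuclideanSpace ℝ (Fin 3) => C₀ * (σ + ‖z‖ ^ 2) ^ (-(2 : ℝ))) (6 / 5) volume ≤
        ENNReal.ofReal (C₆₅ * σ ^ (-(3 / 4 : ℝ))))
    {T : ℝ} {u v : ℝ → EuclideanSpace ℝ (Fin 3) → EuclideanSpace ℝ (Fin 3)}
    (hus : ∀ τ ∈ Ioo 0 T, AEStronglyMeasurable (u τ) volume)
    (hvs : ∀ τ ∈ Ioo 0 T, AEStronglyMeasurable (v τ) volume)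
    {Z Y : ℝ} (hZ : 0 ≤ Z) (hY : 0 ≤ Y)
    (hu6 : ∀ τ ∈ Ioo 0 T, ∀ z : EuclideanSpace ℝ (Fin 3),
      eLpNorm (u τ) 6 (volume.restrict (ball z 1)) ≤ ENNReal.ofReal (Z * τ ^ (-(1 / 4 : ℝ))))
    (hv : ∀ τ ∈ Ioo 0 T, ∀ y, ‖v τ y‖ ≤ Y * τ ^ (-(1 / 2 : ℝ)))
    {A : ℝ≥0∞} (hA : ∀ τ ∈ Ioo 0 T, ∀ z : EuclideanSpace ℝ (Fin 3), ∫⁻ y in ball z 1, ‖u τ y‖ₑ * ‖v τ y‖ₑ ≤ A)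
    {t : ℝ} (ht : t ∈ Ioc 0 T) (x : EuclideanSpace ℝ (Fin 3)) :
    ‖oseenDuhamel 1 0 u v t x‖ₑ ≤
      ENNReal.ofReal (16 * C₆₅ * Z * Y * t ^ (-(1 / 2 : ℝ))) +
        ENNReal.ofReal C₀ * ((volume (ball (0 : EuclideanSpace ℝ (Fin 3)) 1))⁻¹ *
          (A * (25 * ∫⁻ w : EuclideanSpace ℝ (Fin 3), ENNReal.ofReal ((1 + ‖w‖ ^ 2) ^ (-(2 : ℝ)))))) *
          ENNReal.ofReal t := by
  haveI := holderTriple_sixFifths_six_one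
  set Far : ℝ≥0∞ := ENNReal.ofReal C₀ * ((volume (ball (0 : EuclideanSpace ℝ (Fin 3)) 1))⁻¹ *
    (A * (25 * ∫⁻ w : EuclideanSpace ℝ (Fin 3), ENNReal.ofReal ((1 + ‖w‖ ^ 2) ^ (-(2 : ℝ)))))) with hFar
  have ht0 : 0 < t := ht.1
  -- the slice bound
  have hslice : ∀ τ ∈ Ioo 0 t, ‖∫ y, oseenKernel (1 * (t - τ)) (x - y) (u τ y) (v τ y)‖ₑ ≤
      ENNReal.ofReal (C₆₅ * Z * Y) * ENNReal.ofReal ((t - τ) ^ (-(3 / 4 : ℝ)) * τ ^ (-(3 / 4 : ℝ))) + Far := by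
    intro τ hτ
    have hτT : τ ∈ Ioo 0 T := ⟨hτ.1, hτ.2.trans_le ht.2⟩
    have hσ : 0 < 1 * (t - τ) := by rw [one_mul]; exact sub_pos.2 hτ.2
    have h := enorm_oseenSlice_le_uloc hC₀ hK hσ (hus τ hτT) (hvs τ hτT) (hA τ hτT) (6 / 5) 6 x
    refine h.trans (add_le_add ?_ le_rfl)
    -- `‖|u||v|‖_{L⁶(B)} ≤ Y τ^{-1/2} ‖u‖_{L⁶(B)} ≤ Y τ^{-1/2} Z τ^{-1/4}`
    have hprod : eLpNorm (fun y => ‖u τ y‖ * ‖v τ y‖) 6 (volume.restrict (ball x 1)) ≤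
        ENNReal.ofReal (Y * τ ^ (-(1 / 2 : ℝ))) * ENNReal.ofReal (Z * τ ^ (-(1 / 4 : ℝ))) := by
      have hYτ : 0 ≤ Y * τ ^ (-(1 / 2 : ℝ)) := mul_nonneg hY (Real.rpow_nonneg hτ.1.le _)
      have h1 : eLpNorm (fun y => ‖u τ y‖ * ‖v τ y‖) 6 (volume.restrict (ball x 1)) ≤
          (Y * τ ^ (-(1 / 2 : ℝ))).toNNReal • eLpNorm (u τ) 6 (volume.restrict (ball x 1)) := by
        refine eLpNorm_le_nnreal_smul_eLpNorm_of_ae_le_mul (Eventually.of_forall fun y => ?_) 6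
        rw [← NNReal.coe_le_coe, coe_nnnorm, NNReal.coe_mul, coe_nnnorm, Real.norm_eq_abs,
          abs_of_nonneg (mul_nonneg (norm_nonneg _) (norm_nonneg _)), Real.coe_toNNReal _ hYτ, mul_comm]
        exact mul_le_mul_of_nonneg_right (hv τ hτT y) (norm_nonneg _)
      refine h1.trans ?_
      rw [ENNReal.smul_def, smul_eq_mul, ← ENNReal.ofReal_coe_nnreal, Real.coe_toNNReal _ hYτ]
      gcongr
      exact hu6 τ hτT x
    calc eLpNorm (fun z : EuclideanSpace ℝ (Fin 3) => C₀ * (1 * (t - τ) + ‖z‖ ^ 2) ^ (-(2 : ℝ))) (6 / 5) volume *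
          eLpNorm (fun y => ‖u τ y‖ * ‖v τ y‖) 6 (volume.restrict (ball x 1))
        ≤ ENNReal.ofReal (C₆₅ * (1 * (t - τ)) ^ (-(3 / 4 : ℝ))) *
            (ENNReal.ofReal (Y * τ ^ (-(1 / 2 : ℝ))) * ENNReal.ofReal (Z * τ ^ (-(1 / 4 : ℝ)))) :=
          mul_le_mul' (hE _ hσ) hprod
      _ = ENNReal.ofReal (C₆₅ * Z * Y) * ENNReal.ofReal ((t - τ) ^ (-(3 / 4 : ℝ)) * τ ^ (-(3 / 4 : ℝ))) := by
          have hστ : 0 ≤ (t - τ) ^ (-(3 / 4 : ℝ)) := Real.rpow_nonneg (sub_pos.2 hτ.2).le _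
          have hYτ : 0 ≤ Y * τ ^ (-(1 / 2 : ℝ)) := mul_nonneg hY (Real.rpow_nonneg hτ.1.le _)
          rw [one_mul, ← ENNReal.ofReal_mul hYτ, ← ENNReal.ofReal_mul (mul_nonneg hC₆₅ hστ),
            ← ENNReal.ofReal_mul (by positivity)]
          congr 1
          have e : τ ^ (-(1 / 2 : ℝ)) * τ ^ (-(1 / 4 : ℝ)) = τ ^ (-(3 / 4 : ℝ)) := by
            rw [← Real.rpow_add hτ.1]; norm_num
          calc C₆₅ * (t - τ) ^ (-(3 / 4 : ℝ)) * (Y * τ ^ (-(1 / 2 : ℝ)) * (Z * τ ^ (-(1 / 4 : ℝ))))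
              = C₆₅ * Z * Y * ((t - τ) ^ (-(3 / 4 : ℝ)) * (τ ^ (-(1 / 2 : ℝ)) * τ ^ (-(1 / 4 : ℝ)))) := by ring
            _ = _ := by rw [e]
  -- integrate in time
  have hmeas : Measurable fun τ : ℝ => ENNReal.ofReal ((t - τ) ^ (-(3 / 4 : ℝ)) * τ ^ (-(3 / 4 : ℝ))) :=
    (((measurable_const.sub measurable_id).pow_const _).mul (measurable_id.pow_const _)).ennreal_ofReal
  have hbeta := KatoL3.lintegral_Ioo_rpow_mul_rpow_le (α := 3 / 4) (β := 3 / 4) (by norm_num) (by norm_num)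
    (by norm_num) (by norm_num) ht0
  calc ‖oseenDuhamel 1 0 u v t x‖ₑ
      ≤ ∫⁻ τ in Ioo 0 t, ‖∫ y, oseenKernel (1 * (t - τ)) (x - y) (u τ y) (v τ y)‖ₑ :=
        enorm_integral_le_lintegral_enorm _
    _ ≤ ∫⁻ τ in Ioo 0 t, (ENNReal.ofReal (C₆₅ * Z * Y) *
          ENNReal.ofReal ((t - τ) ^ (-(3 / 4 : ℝ)) * τ ^ (-(3 / 4 : ℝ))) + Far) :=
        setLIntegral_mono' measurableSet_Ioo fun τ hτ => hslice τ hτ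
    _ = ENNReal.ofReal (C₆₅ * Z * Y) *
          (∫⁻ τ in Ioo 0 t, ENNReal.ofReal ((t - τ) ^ (-(3 / 4 : ℝ)) * τ ^ (-(3 / 4 : ℝ)))) +
          Far * volume (Ioo (0 : ℝ) t) := by
        rw [lintegral_add_right _ measurable_const, lintegral_const_mul _ hmeas, setLIntegral_const]
    _ ≤ ENNReal.ofReal (C₆₅ * Z * Y) * ENNReal.ofReal (2 * (1 / (1 - 3 / 4) + 1 / (1 - 3 / 4)) *
          t ^ (1 - 3 / 4 - 3 / 4 : ℝ)) + Far * volume (Ioo (0 : ℝ) t) := by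
        gcongr
    _ = _ := by
        rw [Real.volume_Ioo, sub_zero, ← ENNReal.ofReal_mul (by positivity)]
        congr 2
        norm_num
        ring

/-- **Uniformly local `L³` bound of the Duhamel term** (Lemarié-Rieusset 2016, p. 523:
`‖B(v,w)(t)‖_{E³} ≤ C∫(t-s)^{-1/2}‖v(s)‖_{E⁶}‖w(s)‖_{E⁶} ds ≤ C' sup s^{1/4}‖v‖_{E⁶} sup s^{1/4}‖w‖_{E⁶}`,
plus the far part). Unit viscosity, initial time `0`: if `‖u(τ)‖_{L⁶(B(z,1))} ≤ Z_u τ^{-1/4}`,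
`‖v(τ)‖_{L⁶(B(z,1))} ≤ Z_v τ^{-1/4}` and `∫_{B(z,1)} |u(τ)||v(τ)| ≤ A` on `(0,T)`, then for
`0 < t ≤ T` and every centre `x₀`,
`‖B(u,v)(t)‖_{L³(B(x₀,1))} ≤ 8 C₀ I M₆² Z_u Z_v + C₀ C_far A |B₁|^{1/3} t`,
`M₆ = (|B₁|⁻¹|B₃|)^{1/6}`. [cite: LemarieRieusset2016, Thm. 14.8 proof Step 2, p. 523] -/
theorem eLpNorm_ball_oseenDuhamel_le_uloc_weighted {C₀ : ℝ} (hC₀ : 0 ≤ C₀)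
    (hK : ∀ {τ : ℝ}, 0 < τ → ∀ z p q : EuclideanSpace ℝ (Fin 3), ‖oseenKernel τ z p q‖ ≤
      C₀ * (τ + ‖z‖ ^ 2) ^ (-(((Module.finrank ℝ (EuclideanSpace ℝ (Fin 3)) : ℝ) + 1) / 2)) * ‖p‖ * ‖q‖)
    {T : ℝ} {u v : ℝ → EuclideanSpace ℝ (Fin 3) → EuclideanSpace ℝ (Fin 3)}
    (hum : AEStronglyMeasurable (uncurry u) (volume.restrict (Ioo 0 T ×ˢ univ)))
    (hvm : AEStronglyMeasurable (uncurry v) (volume.restrict (Ioo 0 T ×ˢ univ)))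
    (hus : ∀ τ ∈ Ioo 0 T, AEStronglyMeasurable (u τ) volume)
    (hvs : ∀ τ ∈ Ioo 0 T, AEStronglyMeasurable (v τ) volume)
    {Zu Zv : ℝ} (hZu : 0 ≤ Zu) (hZv : 0 ≤ Zv)
    (hu6 : ∀ τ ∈ Ioo 0 T, ∀ z : EuclideanSpace ℝ (Fin 3),
      eLpNorm (u τ) 6 (volume.restrict (ball z 1)) ≤ ENNReal.ofReal (Zu * τ ^ (-(1 / 4 : ℝ))))
    (hv6 : ∀ τ ∈ Ioo 0 T, ∀ z : EuclideanSpace ℝ (Fin 3),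
      eLpNorm (v τ) 6 (volume.restrict (ball z 1)) ≤ ENNReal.ofReal (Zv * τ ^ (-(1 / 4 : ℝ))))
    {A : ℝ≥0∞} (hA : ∀ τ ∈ Ioo 0 T, ∀ z : EuclideanSpace ℝ (Fin 3), ∫⁻ y in ball z 1, ‖u τ y‖ₑ * ‖v τ y‖ₑ ≤ A)
    {t : ℝ} (ht : t ∈ Ioc 0 T) (x₀ : EuclideanSpace ℝ (Fin 3)) :
    eLpNorm (oseenDuhamel 1 0 u v t) 3 (volume.restrict (ball x₀ 1)) ≤
      ENNReal.ofReal (8 * C₀ * (∫ w : EuclideanSpace ℝ (Fin 3), (1 + ‖w‖ ^ 2) ^ (-(2 : ℝ))) * Zu * Zv) *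
          ((volume (ball (0 : EuclideanSpace ℝ (Fin 3)) 1))⁻¹ *
            volume (ball (0 : EuclideanSpace ℝ (Fin 3)) 3)) ^ (1 / (3 : ℝ)) +
        ENNReal.ofReal C₀ * ((volume (ball (0 : EuclideanSpace ℝ (Fin 3)) 1))⁻¹ *
          (A * (25 * ∫⁻ w : EuclideanSpace ℝ (Fin 3), ENNReal.ofReal ((1 + ‖w‖ ^ 2) ^ (-(2 : ℝ)))))) *
          volume (ball x₀ 1) ^ (1 / (3 : ℝ)) * ENNReal.ofReal t := by
  haveI := holderTriple_six_six_three
  set I : ℝ := ∫ w : EuclideanSpace ℝ (Fin 3), (1 + ‖w‖ ^ 2) ^ (-(2 : ℝ)) with hI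
  have hI0 : 0 ≤ I := integral_nonneg fun w => Real.rpow_nonneg (by positivity) _
  set M : ℝ≥0∞ := ((volume (ball (0 : EuclideanSpace ℝ (Fin 3)) 1))⁻¹ *
    volume (ball (0 : EuclideanSpace ℝ (Fin 3)) 3)) ^ (1 / (6 : ℝ≥0∞).toReal) with hM
  set Far : ℝ≥0∞ := ENNReal.ofReal C₀ * ((volume (ball (0 : EuclideanSpace ℝ (Fin 3)) 1))⁻¹ *
    (A * (25 * ∫⁻ w : EuclideanSpace ℝ (Fin 3), ENNReal.ofReal ((1 + ‖w‖ ^ 2) ^ (-(2 : ℝ)))))) *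
    volume (ball x₀ 1) ^ (1 / (3 : ℝ≥0∞).toReal) with hFar
  have ht0 : 0 < t := ht.1
  set μτ : Measure ℝ := volume.restrict (Ioo 0 t) with hμτ
  haveI : SFinite μτ := by rw [hμτ]; infer_instance
  have hsub : Ioo 0 t ×ˢ (univ : Set (EuclideanSpace ℝ (Fin 3))) ⊆ Ioo 0 T ×ˢ univ :=
    prod_mono (Ioo_subset_Ioo_right ht.2) subset_rfl
  have hum' := hum.mono_measure (Measure.restrict_mono hsub le_rfl)
  have hvm' := hvm.mono_measure (Measure.restrict_mono hsub le_rfl)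
  set F : EuclideanSpace ℝ (Fin 3) → ℝ → EuclideanSpace ℝ (Fin 3) :=
    fun x τ => ∫ y, oseenKernel (1 * (t - τ)) (x - y) (u τ y) (v τ y) with hF
  have hB : oseenDuhamel 1 0 u v t = fun x => ∫ τ, F x τ ∂μτ := rfl
  -- Minkowski in time, on the ball
  have hFm : AEStronglyMeasurable (uncurry F) ((volume.restrict (ball x₀ 1)).prod μτ) :=
    (aestronglyMeasurable_uncurry_oseenSlice 1 t hum' hvm').mono_measure
      (Measure.prod_mono Measure.restrict_le_self le_rfl)
  have hMink := FunctionSpaces.eLpNorm_integral_le_lintegral_eLpNorm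
    (μ := volume.restrict (ball x₀ 1)) (ν := μτ) hFm (p := 3) (by norm_num) (by norm_num)
  -- the slice bound
  have hslice : ∀ τ ∈ Ioo 0 t, eLpNorm (fun x => F x τ) 3 (volume.restrict (ball x₀ 1)) ≤
      ENNReal.ofReal (C₀ * I * Zu * Zv) * M * M * ENNReal.ofReal ((t - τ) ^ (-(1 / 2 : ℝ)) * τ ^ (-(1 / 2 : ℝ))) +
        Far := by
    intro τ hτ
    have hτT : τ ∈ Ioo 0 T := ⟨hτ.1, hτ.2.trans_le ht.2⟩
    have hσ : 0 < 1 * (t - τ) := by rw [one_mul]; exact sub_pos.2 hτ.2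
    have h := eLpNorm_ball_oseenSlice_le hC₀ hK hσ (hus τ hτT) (hvs τ hτT) (hA τ hτT) (q := 3)
      (by norm_num) (by norm_num) x₀
    refine h.trans (add_le_add ?_ le_rfl)
    -- `‖|u||v|‖_{L³(B₂)} ≤ ‖u‖_{L⁶(B₂)} ‖v‖_{L⁶(B₂)} ≤ (M Zu τ^{-1/4}) (M Zv τ^{-1/4})`
    have hu2 := eLpNorm_ball_two_le_of_forall_unitBall (hus τ hτT) (q := 6) (by norm_num) (by norm_num)
      (hu6 τ hτT) x₀
    have hv2 := eLpNorm_ball_two_le_of_forall_unitBall (hvs τ hτT) (q := 6) (by norm_num) (by norm_num)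
      (hv6 τ hτT) x₀
    have hprod : eLpNorm (fun y => ‖u τ y‖ * ‖v τ y‖) 3 (volume.restrict (ball x₀ 2)) ≤
        eLpNorm (u τ) 6 (volume.restrict (ball x₀ 2)) * eLpNorm (v τ) 6 (volume.restrict (ball x₀ 2)) := by
      have h := eLpNorm_smul_le_mul_eLpNorm (p := 6) (q := 6) (r := 3) (hvs τ hτT).norm.restrict
        (hus τ hτT).norm.restrict (μ := volume.restrict (ball x₀ 2))
      have heq : ((fun y => ‖u τ y‖) • fun y => ‖v τ y‖) = fun y => ‖u τ y‖ * ‖v τ y‖ := rfl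
      rw [heq, eLpNorm_norm, eLpNorm_norm] at h
      exact h
    calc ENNReal.ofReal (C₀ * ((1 * (t - τ)) ^ (-(1 / 2 : ℝ)) * I)) *
          eLpNorm (fun y => ‖u τ y‖ * ‖v τ y‖) 3 (volume.restrict (ball x₀ 2))
        ≤ ENNReal.ofReal (C₀ * ((1 * (t - τ)) ^ (-(1 / 2 : ℝ)) * I)) *
            ((M * ENNReal.ofReal (Zu * τ ^ (-(1 / 4 : ℝ)))) * (M * ENNReal.ofReal (Zv * τ ^ (-(1 / 4 : ℝ))))) :=
          mul_le_mul' le_rfl (hprod.trans (mul_le_mul' hu2 hv2))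
      _ = ENNReal.ofReal (C₀ * I * Zu * Zv) * M * M *
            ENNReal.ofReal ((t - τ) ^ (-(1 / 2 : ℝ)) * τ ^ (-(1 / 2 : ℝ))) := by
          have h1 : 0 ≤ (t - τ) ^ (-(1 / 2 : ℝ)) := Real.rpow_nonneg (sub_pos.2 hτ.2).le _
          have h2 : 0 ≤ τ ^ (-(1 / 4 : ℝ)) := Real.rpow_nonneg hτ.1.le _
          have e : τ ^ (-(1 / 4 : ℝ)) * τ ^ (-(1 / 4 : ℝ)) = τ ^ (-(1 / 2 : ℝ)) := by
            rw [← Real.rpow_add hτ.1]; norm_num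
          rw [one_mul]
          calc ENNReal.ofReal (C₀ * ((t - τ) ^ (-(1 / 2 : ℝ)) * I)) *
                (M * ENNReal.ofReal (Zu * τ ^ (-(1 / 4 : ℝ))) * (M * ENNReal.ofReal (Zv * τ ^ (-(1 / 4 : ℝ)))))
              = M * M * (ENNReal.ofReal (C₀ * ((t - τ) ^ (-(1 / 2 : ℝ)) * I)) *
                  ENNReal.ofReal (Zu * τ ^ (-(1 / 4 : ℝ))) * ENNReal.ofReal (Zv * τ ^ (-(1 / 4 : ℝ)))) := by ring
            _ = M * M * ENNReal.ofReal (C₀ * ((t - τ) ^ (-(1 / 2 : ℝ)) * I) *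
                  (Zu * τ ^ (-(1 / 4 : ℝ))) * (Zv * τ ^ (-(1 / 4 : ℝ)))) := by
                rw [← ENNReal.ofReal_mul (by positivity), ← ENNReal.ofReal_mul (by positivity)]
            _ = M * M * ENNReal.ofReal ((C₀ * I * Zu * Zv) * ((t - τ) ^ (-(1 / 2 : ℝ)) * τ ^ (-(1 / 2 : ℝ)))) := by
                congr 2
                calc C₀ * ((t - τ) ^ (-(1 / 2 : ℝ)) * I) * (Zu * τ ^ (-(1 / 4 : ℝ))) * (Zv * τ ^ (-(1 / 4 : ℝ)))
                    = C₀ * I * Zu * Zv * ((t - τ) ^ (-(1 / 2 : ℝ)) * (τ ^ (-(1 / 4 : ℝ)) * τ ^ (-(1 / 4 : ℝ)))) := by ring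
                  _ = _ := by rw [e]
            _ = _ := by
                rw [ENNReal.ofReal_mul (by positivity)]
                ring
  -- integrate in time
  have hmeas : Measurable fun τ : ℝ => ENNReal.ofReal ((t - τ) ^ (-(1 / 2 : ℝ)) * τ ^ (-(1 / 2 : ℝ))) :=
    (((measurable_const.sub measurable_id).pow_const _).mul (measurable_id.pow_const _)).ennreal_ofReal
  have hbeta := KatoL3.lintegral_Ioo_rpow_mul_rpow_le (α := 1 / 2) (β := 1 / 2) (by norm_num) (by norm_num)
    (by norm_num) (by norm_num) ht0
  have hM3 : M * M = ((volume (ball (0 : EuclideanSpace ℝ (Fin 3)) 1))⁻¹ *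
      volume (ball (0 : EuclideanSpace ℝ (Fin 3)) 3)) ^ (1 / (3 : ℝ)) := by
    rw [hM, ← ENNReal.rpow_add_of_nonneg _ _ (by positivity) (by positivity)]
    norm_num
  calc eLpNorm (oseenDuhamel 1 0 u v t) 3 (volume.restrict (ball x₀ 1))
      = eLpNorm (fun x => ∫ τ, F x τ ∂μτ) 3 (volume.restrict (ball x₀ 1)) := by rw [hB]
    _ ≤ ∫⁻ τ, eLpNorm (fun x => F x τ) 3 (volume.restrict (ball x₀ 1)) ∂μτ := hMink
    _ ≤ ∫⁻ τ in Ioo 0 t, (ENNReal.ofReal (C₀ * I * Zu * Zv) * M * M *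
          ENNReal.ofReal ((t - τ) ^ (-(1 / 2 : ℝ)) * τ ^ (-(1 / 2 : ℝ))) + Far) :=
        setLIntegral_mono' measurableSet_Ioo fun τ hτ => hslice τ hτ
    _ = ENNReal.ofReal (C₀ * I * Zu * Zv) * M * M *
          (∫⁻ τ in Ioo 0 t, ENNReal.ofReal ((t - τ) ^ (-(1 / 2 : ℝ)) * τ ^ (-(1 / 2 : ℝ)))) +
          Far * volume (Ioo (0 : ℝ) t) := by
        rw [lintegral_add_right _ measurable_const, lintegral_const_mul _ hmeas, setLIntegral_const]
    _ ≤ ENNReal.ofReal (C₀ * I * Zu * Zv) * M * M *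
          ENNReal.ofReal (2 * (1 / (1 - 1 / 2) + 1 / (1 - 1 / 2)) * t ^ (1 - 1 / 2 - 1 / 2 : ℝ)) +
          Far * volume (Ioo (0 : ℝ) t) := by
        gcongr
    _ = _ := by
        have key : ENNReal.ofReal (C₀ * I * Zu * Zv) * M * M *
            ENNReal.ofReal (2 * (1 / (1 - 1 / 2) + 1 / (1 - 1 / 2)) * t ^ (1 - 1 / 2 - 1 / 2 : ℝ)) =
            ENNReal.ofReal (8 * C₀ * I * Zu * Zv) * ((volume (ball (0 : EuclideanSpace ℝ (Fin 3)) 1))⁻¹ *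
              volume (ball (0 : EuclideanSpace ℝ (Fin 3)) 3)) ^ (1 / (3 : ℝ)) := by
          rw [mul_assoc _ M M, hM3, mul_right_comm, ← ENNReal.ofReal_mul (by positivity)]
          congr 2
          norm_num
          ring
        rw [Real.volume_Ioo, sub_zero, key, hFar, ENNReal.toReal_ofNat]

/-- **Global `L³` bound of the Duhamel term with a weighted bounded factor**
(Lemarié-Rieusset 2016, Thm. 7.5 / proof of Thm. 9.11 with the weight `√s`: Minkowski in time,
`‖T_σ‖_{3→3} ≤ C σ^{-1/2}` and `∫₀ᵗ (t-s)^{-1/2}s^{-1/2} ds ≤ 8`): if `‖v(τ,y)‖ ≤ Y τ^{-1/2}` and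
`‖u(τ)‖_{L³} ≤ L` on `(0,T)`, then `‖B(u,v)(t)‖_{L³} ≤ 8 C₀ M₁ Y · L` for `0 < t ≤ T`.
[cite: LemarieRieusset2016, Thm. 7.5 (proof, PDF pp. 156–157)] -/
theorem eLpNorm_three_oseenDuhamel_le_weighted {C₀ : ℝ} (hC₀ : 0 ≤ C₀)
    (hK : ∀ {τ : ℝ}, 0 < τ → ∀ z p q : EuclideanSpace ℝ (Fin 3), ‖oseenKernel τ z p q‖ ≤
      C₀ * (τ + ‖z‖ ^ 2) ^ (-(((Module.finrank ℝ (EuclideanSpace ℝ (Fin 3)) : ℝ) + 1) / 2)) * ‖p‖ * ‖q‖)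
    {T : ℝ} {u v : ℝ → EuclideanSpace ℝ (Fin 3) → EuclideanSpace ℝ (Fin 3)}
    (hum : AEStronglyMeasurable (uncurry u) (volume.restrict (Ioo 0 T ×ˢ univ)))
    (hvm : AEStronglyMeasurable (uncurry v) (volume.restrict (Ioo 0 T ×ˢ univ)))
    (hus : ∀ τ ∈ Ioo 0 T, AEStronglyMeasurable (u τ) volume)
    (hvs : ∀ τ ∈ Ioo 0 T, AEStronglyMeasurable (v τ) volume)
    {Y : ℝ} (hY : 0 ≤ Y) (hv : ∀ τ ∈ Ioo 0 T, ∀ y, ‖v τ y‖ ≤ Y * τ ^ (-(1 / 2 : ℝ)))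
    {L : ℝ≥0∞} (hL : ∀ τ ∈ Ioo 0 T, eLpNorm (u τ) 3 volume ≤ L)
    {t : ℝ} (ht : t ∈ Ioc 0 T) :
    eLpNorm (oseenDuhamel 1 0 u v t) 3 volume ≤
      ENNReal.ofReal (8 * C₀ * (∫ w : EuclideanSpace ℝ (Fin 3),
        (1 + ‖w‖ ^ 2) ^ (-(((Module.finrank ℝ (EuclideanSpace ℝ (Fin 3)) : ℝ) + 1) / 2))) * Y) * L := by
  set I : ℝ := ∫ w : EuclideanSpace ℝ (Fin 3),
    (1 + ‖w‖ ^ 2) ^ (-(((Module.finrank ℝ (EuclideanSpace ℝ (Fin 3)) : ℝ) + 1) / 2)) with hI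
  have hI0 : 0 ≤ I := integral_nonneg fun w => Real.rpow_nonneg (by positivity) _
  have ht0 : 0 < t := ht.1
  set μτ : Measure ℝ := volume.restrict (Ioo 0 t) with hμτ
  haveI : SFinite μτ := by rw [hμτ]; infer_instance
  have hsub : Ioo 0 t ×ˢ (univ : Set (EuclideanSpace ℝ (Fin 3))) ⊆ Ioo 0 T ×ˢ univ :=
    prod_mono (Ioo_subset_Ioo_right ht.2) subset_rfl
  have hum' := hum.mono_measure (Measure.restrict_mono hsub le_rfl)
  have hvm' := hvm.mono_measure (Measure.restrict_mono hsub le_rfl)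
  set F : EuclideanSpace ℝ (Fin 3) → ℝ → EuclideanSpace ℝ (Fin 3) :=
    fun x τ => ∫ y, oseenKernel (1 * (t - τ)) (x - y) (u τ y) (v τ y) with hF
  have hB : oseenDuhamel 1 0 u v t = fun x => ∫ τ, F x τ ∂μτ := rfl
  have hMink := FunctionSpaces.eLpNorm_integral_le_lintegral_eLpNorm
    (μ := (volume : Measure (EuclideanSpace ℝ (Fin 3)))) (ν := μτ)
    (aestronglyMeasurable_uncurry_oseenSlice 1 t hum' hvm') (p := 3) (by norm_num) (by norm_num)
  have hslice : ∀ τ ∈ Ioo 0 t, eLpNorm (fun x => F x τ) 3 volume ≤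
      ENNReal.ofReal (C₀ * I * Y) * ENNReal.ofReal ((t - τ) ^ (-(1 / 2 : ℝ)) * τ ^ (-(1 / 2 : ℝ))) * L := by
    intro τ hτ
    have hτT : τ ∈ Ioo 0 T := ⟨hτ.1, hτ.2.trans_le ht.2⟩
    have hσ : 0 < 1 * (t - τ) := by rw [one_mul]; exact sub_pos.2 hτ.2
    have h1 := eLpNorm_oseenSlice_le_same hC₀ hK hσ (hus τ hτT) (hvs τ hτT) (p := 3) (by norm_num)
    have hYτ : 0 ≤ Y * τ ^ (-(1 / 2 : ℝ)) := mul_nonneg hY (Real.rpow_nonneg hτ.1.le _)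
    have h2 : eLpNorm (fun y => ‖u τ y‖ * ‖v τ y‖) 3 volume ≤ (Y * τ ^ (-(1 / 2 : ℝ))).toNNReal • eLpNorm (u τ) 3 volume := by
      refine eLpNorm_le_nnreal_smul_eLpNorm_of_ae_le_mul (Eventually.of_forall fun y => ?_) 3
      rw [← NNReal.coe_le_coe, coe_nnnorm, NNReal.coe_mul, coe_nnnorm, Real.norm_eq_abs,
        abs_of_nonneg (mul_nonneg (norm_nonneg _) (norm_nonneg _)), Real.coe_toNNReal _ hYτ, mul_comm]
      exact mul_le_mul_of_nonneg_right (hv τ hτT y) (norm_nonneg _)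
    calc eLpNorm (fun x => F x τ) 3 volume
        ≤ ENNReal.ofReal (C₀ * ((1 * (t - τ)) ^ (-(1 / 2 : ℝ)) * I)) *
            eLpNorm (fun y => ‖u τ y‖ * ‖v τ y‖) 3 volume := h1
      _ ≤ ENNReal.ofReal (C₀ * ((1 * (t - τ)) ^ (-(1 / 2 : ℝ)) * I)) *
            ((Y * τ ^ (-(1 / 2 : ℝ))).toNNReal • L) := by
          gcongr
          exact h2.trans (by gcongr; exact hL τ hτT)
      _ = ENNReal.ofReal (C₀ * I * Y) * ENNReal.ofReal ((t - τ) ^ (-(1 / 2 : ℝ)) * τ ^ (-(1 / 2 : ℝ))) * L := by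
          have h1' : 0 ≤ (t - τ) ^ (-(1 / 2 : ℝ)) := Real.rpow_nonneg (sub_pos.2 hτ.2).le _
          rw [ENNReal.smul_def, smul_eq_mul, ← ENNReal.ofReal_coe_nnreal, Real.coe_toNNReal _ hYτ,
            ← mul_assoc, one_mul, ← ENNReal.ofReal_mul (by positivity), ← ENNReal.ofReal_mul (by positivity)]
          congr 2
          ring
  have hmeas : Measurable fun τ : ℝ => ENNReal.ofReal ((t - τ) ^ (-(1 / 2 : ℝ)) * τ ^ (-(1 / 2 : ℝ))) :=
    (((measurable_const.sub measurable_id).pow_const _).mul (measurable_id.pow_const _)).ennreal_ofReal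
  have hbeta := KatoL3.lintegral_Ioo_rpow_mul_rpow_le (α := 1 / 2) (β := 1 / 2) (by norm_num) (by norm_num)
    (by norm_num) (by norm_num) ht0
  calc eLpNorm (oseenDuhamel 1 0 u v t) 3 volume
      = eLpNorm (fun x => ∫ τ, F x τ ∂μτ) 3 volume := by rw [hB]
    _ ≤ ∫⁻ τ, eLpNorm (fun x => F x τ) 3 volume ∂μτ := hMink
    _ ≤ ∫⁻ τ in Ioo 0 t, ENNReal.ofReal (C₀ * I * Y) *
          ENNReal.ofReal ((t - τ) ^ (-(1 / 2 : ℝ)) * τ ^ (-(1 / 2 : ℝ))) * L :=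
        setLIntegral_mono' measurableSet_Ioo fun τ hτ => hslice τ hτ
    _ = ENNReal.ofReal (C₀ * I * Y) *
          (∫⁻ τ in Ioo 0 t, ENNReal.ofReal ((t - τ) ^ (-(1 / 2 : ℝ)) * τ ^ (-(1 / 2 : ℝ)))) * L := by
        rw [lintegral_mul_const _ (hmeas.const_mul _), lintegral_const_mul _ hmeas]
    _ ≤ ENNReal.ofReal (C₀ * I * Y) *
          ENNReal.ofReal (2 * (1 / (1 - 1 / 2) + 1 / (1 - 1 / 2)) * t ^ (1 - 1 / 2 - 1 / 2 : ℝ)) * L := by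
        gcongr
    _ = _ := by
        rw [← ENNReal.ofReal_mul (by positivity)]
        congr 2
        norm_num
        ring

end Duhamel

/-! ### The heat extension in the uniformly local classes -/

section HeatUloc

/-- **Interpolation `L⁶ ⊂ L³ ∩ L^∞`**: if `‖g(y)‖ ≤ M` for all `y` then
`‖g‖_{L⁶(μ)} ≤ M^{1/2} ‖g‖_{L³(μ)}^{1/2}` (`∫ |g|⁶ ≤ M³ ∫ |g|³`). [folklore] -/
theorem eLpNorm_six_le_of_bound_of_three {X : Type*} [MeasurableSpace X] {μ : Measure X}
    {F : Type*} [NormedAddCommGroup F] {g : X → F} {M : ℝ} (hg : ∀ y, ‖g y‖ ≤ M) :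
    eLpNorm g 6 μ ≤ ENNReal.ofReal M ^ (1 / 2 : ℝ) * eLpNorm g 3 μ ^ (1 / 2 : ℝ) := by
  rw [eLpNorm_eq_lintegral_rpow_enorm_toReal (by norm_num) (by norm_num),
    eLpNorm_eq_lintegral_rpow_enorm_toReal (by norm_num) (by norm_num), ENNReal.toReal_ofNat, ENNReal.toReal_ofNat]
  have hpt : ∀ y, ‖g y‖ₑ ^ (6 : ℝ) ≤ ENNReal.ofReal M ^ (3 : ℝ) * ‖g y‖ₑ ^ (3 : ℝ) := fun y => by
    have h1 : ‖g y‖ₑ ≤ ENNReal.ofReal M := by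
      rw [← ofReal_norm]; exact ENNReal.ofReal_le_ofReal (hg y)
    calc ‖g y‖ₑ ^ (6 : ℝ) = ‖g y‖ₑ ^ (3 : ℝ) * ‖g y‖ₑ ^ (3 : ℝ) := by
          rw [← ENNReal.rpow_add_of_nonneg _ _ (by norm_num) (by norm_num)]; norm_num
      _ ≤ ENNReal.ofReal M ^ (3 : ℝ) * ‖g y‖ₑ ^ (3 : ℝ) := by gcongr
  calc (∫⁻ y, ‖g y‖ₑ ^ (6 : ℝ) ∂μ) ^ (1 / (6 : ℝ))
      ≤ (∫⁻ y, ENNReal.ofReal M ^ (3 : ℝ) * ‖g y‖ₑ ^ (3 : ℝ) ∂μ) ^ (1 / (6 : ℝ)) := by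
        gcongr ?_ ^ _
        exact lintegral_mono hpt
    _ = (ENNReal.ofReal M ^ (3 : ℝ) * ∫⁻ y, ‖g y‖ₑ ^ (3 : ℝ) ∂μ) ^ (1 / (6 : ℝ)) := by
        rw [lintegral_const_mul' _ _ (ENNReal.rpow_ne_top_of_nonneg (by norm_num) ENNReal.ofReal_ne_top)]
    _ = ENNReal.ofReal M ^ (1 / 2 : ℝ) * ((∫⁻ y, ‖g y‖ₑ ^ (3 : ℝ) ∂μ) ^ (1 / (3 : ℝ))) ^ (1 / 2 : ℝ) := by
        rw [ENNReal.mul_rpow_of_nonneg _ _ (by norm_num), ← ENNReal.rpow_mul, ← ENNReal.rpow_mul]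
        norm_num

/-- **The heat extension in `L³_uloc`** (Lemarié-Rieusset 2016, p. 521,
"`sup_{0<τ<1} ‖e^{ντΔ}u‖_{L³_uloc} ≤ ‖u‖_{L³_uloc}`", up to constants and the far part): if
`‖f‖_{L³(B(z,1))} ≤ X` for all `z`, then for `s > 0` and every `x₀`,
`‖e^{sΔ}f‖_{L³(B(x₀,1))} ≤ (C_h I M₃ + C_h s^{1/2} C_far |B₁|^{2/3} |B₁|^{1/3}) X`.
[cite: LemarieRieusset2016, Thm. 14.8 proof Step 2, p. 521] -/
theorem eLpNorm_ball_heatExtension_le_uloc {F : Type*} [NormedAddCommGroup F] [NormedSpace ℝ F]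
    {Ch : ℝ} (hCh : 0 ≤ Ch)
    (hG : ∀ {s : ℝ}, 0 < s → ∀ z : EuclideanSpace ℝ (Fin 3),
      UnboundedOperators.heatKernel s z ≤ Ch * s ^ (1 / 2 : ℝ) * (s + ‖z‖ ^ 2) ^ (-(2 : ℝ)))
    {s : ℝ} (hs : 0 < s) {f : EuclideanSpace ℝ (Fin 3) → F} (hf : AEStronglyMeasurable f volume)
    {X : ℝ≥0∞} (hX : ∀ z : EuclideanSpace ℝ (Fin 3), eLpNorm f 3 (volume.restrict (ball z 1)) ≤ X)
    (x₀ : EuclideanSpace ℝ (Fin 3)) :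
    eLpNorm (UnboundedOperators.heatExtension f s) 3 (volume.restrict (ball x₀ 1)) ≤
      (ENNReal.ofReal (Ch * ∫ w : EuclideanSpace ℝ (Fin 3), (1 + ‖w‖ ^ 2) ^ (-(2 : ℝ))) *
          ((volume (ball (0 : EuclideanSpace ℝ (Fin 3)) 1))⁻¹ *
            volume (ball (0 : EuclideanSpace ℝ (Fin 3)) 3)) ^ (1 / (3 : ℝ)) +
        ENNReal.ofReal (Ch * s ^ (1 / 2 : ℝ)) * ((volume (ball (0 : EuclideanSpace ℝ (Fin 3)) 1))⁻¹ *
          (25 * ∫⁻ w : EuclideanSpace ℝ (Fin 3), ENNReal.ofReal ((1 + ‖w‖ ^ 2) ^ (-(2 : ℝ))))) *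
          volume (ball (0 : EuclideanSpace ℝ (Fin 3)) 1) ^ (1 - 1 / (3 : ℝ)) *
          volume (ball (0 : EuclideanSpace ℝ (Fin 3)) 1) ^ (1 / (3 : ℝ))) * X := by
  have hA₁ : ∀ z : EuclideanSpace ℝ (Fin 3), ∫⁻ y in ball z 1, ‖f y‖ₑ ≤
      volume (ball (0 : EuclideanSpace ℝ (Fin 3)) 1) ^ (1 - 1 / (3 : ℝ≥0∞).toReal) * X := fun z =>
    (lintegral_ball_enorm_le_mul_eLpNorm hf (q := 3) (by norm_num) z).trans (mul_le_mul' le_rfl (hX z))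
  have h := eLpNorm_ball_heatExtension_le hCh hG hs hf hA₁ (q := 3) (by norm_num) (by norm_num) x₀
  have h2 := eLpNorm_ball_two_le_of_forall_unitBall hf (q := 3) (by norm_num) (by norm_num) hX x₀
  refine h.trans ?_
  rw [ENNReal.toReal_ofNat] at h2 hA₁ ⊢
  rw [Measure.addHaar_ball_center volume x₀, add_mul]
  refine add_le_add ?_ (le_of_eq ?_)
  · calc _ ≤ ENNReal.ofReal (Ch * ∫ w : EuclideanSpace ℝ (Fin 3), (1 + ‖w‖ ^ 2) ^ (-(2 : ℝ))) *
          (((volume (ball (0 : EuclideanSpace ℝ (Fin 3)) 1))⁻¹ *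
            volume (ball (0 : EuclideanSpace ℝ (Fin 3)) 3)) ^ (1 / (3 : ℝ)) * X) := mul_le_mul' le_rfl h2
      _ = _ := by ring
  · rw [ulocFarTerm_eq]
    ring

/-- **The heat extension, weighted sup bound from `L³_uloc`** (Lemarié-Rieusset 2016, p. 522,
"`sup_{0<τ<1} √τ‖e^{ντΔ}u‖_∞ ≤ C_ν‖u‖_{L³_uloc}`", plus the far part): if
`‖(C_h s^{1/2}) Env_s‖_{L^{3/2}} ≤ C₃₂ s^{-1/2}` and `‖f‖_{L³(B(z,1))} ≤ X` for all `z`, then for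
every `x`, `‖e^{sΔ}f(x)‖ ≤ (C₃₂ s^{-1/2} + C_h s^{1/2} C_far |B₁|^{2/3}) X`.
[cite: LemarieRieusset2016, Thm. 14.8 proof Step 2, p. 522] -/
theorem enorm_heatExtension_le_uloc_three {F : Type*} [NormedAddCommGroup F] [NormedSpace ℝ F]
    {Ch : ℝ} (hCh : 0 ≤ Ch)
    (hG : ∀ {s : ℝ}, 0 < s → ∀ z : EuclideanSpace ℝ (Fin 3),
      UnboundedOperators.heatKernel s z ≤ Ch * s ^ (1 / 2 : ℝ) * (s + ‖z‖ ^ 2) ^ (-(2 : ℝ)))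
    {C₃₂ : ℝ} {s : ℝ} (hs : 0 < s)
    (hE : eLpNorm (fun z : EuclideanSpace ℝ (Fin 3) => (Ch * s ^ (1 / 2 : ℝ)) * (s + ‖z‖ ^ 2) ^ (-(2 : ℝ)))
      (3 / 2) volume ≤ ENNReal.ofReal (C₃₂ * s ^ (-(1 / 2 : ℝ))))
    {f : EuclideanSpace ℝ (Fin 3) → F} (hf : AEStronglyMeasurable f volume)
    {X : ℝ≥0∞} (hX : ∀ z : EuclideanSpace ℝ (Fin 3), eLpNorm f 3 (volume.restrict (ball z 1)) ≤ X)
    (x : EuclideanSpace ℝ (Fin 3)) :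
    ‖UnboundedOperators.heatExtension f s x‖ₑ ≤
      (ENNReal.ofReal (C₃₂ * s ^ (-(1 / 2 : ℝ))) +
        ENNReal.ofReal (Ch * s ^ (1 / 2 : ℝ)) * ((volume (ball (0 : EuclideanSpace ℝ (Fin 3)) 1))⁻¹ *
          (25 * ∫⁻ w : EuclideanSpace ℝ (Fin 3), ENNReal.ofReal ((1 + ‖w‖ ^ 2) ^ (-(2 : ℝ))))) *
          volume (ball (0 : EuclideanSpace ℝ (Fin 3)) 1) ^ (1 - 1 / (3 : ℝ))) * X := by
  haveI := ulocHolderConjugate_threeHalves_three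
  have hA₁ : ∀ z : EuclideanSpace ℝ (Fin 3), ∫⁻ y in ball z 1, ‖f y‖ₑ ≤
      volume (ball (0 : EuclideanSpace ℝ (Fin 3)) 1) ^ (1 - 1 / (3 : ℝ≥0∞).toReal) * X := fun z =>
    (lintegral_ball_enorm_le_mul_eLpNorm hf (q := 3) (by norm_num) z).trans (mul_le_mul' le_rfl (hX z))
  have h := enorm_heatExtension_le_uloc hCh hG hs hf hA₁ (3 / 2) 3 x
  refine h.trans ?_
  rw [ENNReal.toReal_ofNat, add_mul]
  refine add_le_add (mul_le_mul' hE (hX x)) (le_of_eq ?_)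
  rw [ulocFarTerm_eq]
  ring

end HeatUloc

end Literature.Analysis.FluidPDE
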